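import Literature.Computability.AlgebraicComplexity.MatMulNsmRankFiniteField
import Literature.LinearAlgebra.Matrix.FiniteFieldRankCount
import HarnessLib

/-!
# Nazarov 2023: the rank-class count of `L*` (Lemma 2) and the proof of the Theorem for `s ≥ n ≥ 3`

Topic `Literature/Computability/AlgebraicComplexity`. PROVED theorems only (no named fact); this file
DISCHARGES the named fact `nazarov2023_rank_matMulTensor_ge` of `Nazarov2023FiniteFieldRankBound.lean`
(`nazarov2023_rank_matMulTensor_ge_holds`).

The tree already carries every step of the printed proof except Lemma 2:
Lemma 1 (`Literature.LinearAlgebra.Matrix.card_rank_eq_qBinomial_mul_prod`), Lemmas 3, 5, 6 and the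
assembly "the Theorem follows from Lemmas 2–4" for general `2 ≤ n ≤ s`
(`nazarov2023_rank_matMulTensor_ge_of_count`, `MatMulNsmRankFiniteField.lean`), Lemma 4 = Lemma 7
(`Nazarov2023.typeStar_bound_general`) and the cases `n = 2` (`nazarov2023_rank_matMulTensor_ge_n2`,
`MatMul2smRankFiniteField.lean`). Here:

* **Lemma 2** (source pp. 44–47): the number `v*_r` of rank-`r` matrices in the `(n−1)s`-dimensional
  space `L* ⊆ F^{n×s}` and the inequality `q*_r = v*_r / R_r^{(n,s)} ≥ 1/f(K,n,s)` for `s ≥ n ≥ 3`.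
  We follow the printed computation: a matrix of `L*` is determined by its first `n − 1` rows `C`, its
  last row being `L_n = (−D, 0)` with `D` the last column of `C`; `rank = rank C + [L_n ∉ rows C]`;
  the case `D = 0` contributes `R_r^{(n−1,s−1)}` (`X₀`); for `D ≠ 0` the row operation normalising the
  last column to `(1,0,…,0)ᵀ` (the source's family `M*`) reduces everything to `(n−2) × (s−1)` matrices
  `N` and the fixed nonzero row `L'_n`, and "the share of the rank-`(r−1)` matrices `N` whose rows
  express `L'_n` is `α = (K^{r−1} − 1)/(K^{s−1} − 1)`" is the Grassmannian count
  `#{W ∋ v : dim W = r−1} = [s−2 choose r−2]_K` (`Literature.LinearAlgebra.Subspace.card_ge_codim_eq_qBinomial`)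
  against `#{W : dim W = r−1} = [s−1 choose r−1]_K`.  The resulting closed form is
  `v*_r = R_r^{(n−1,s−1)} + (K^{n−1} − 1) K^{n+s−3} [s−2 choose r−2]_K ∏_{i<r−2} (K^{n−2} − K^i)` (`r ≥ 2`),
  `v*_1 = R_1^{(n−1,s−1)}`, which is the printed `X₀ + X_lin + X̄_lin` (p. 45).
* The minimisation of `q*_r` over `r` (pp. 46–47: minimum at `r = s − 1` for `s = n`, at `r = n` for
  `s > n`, value exactly `1/f`) is done here as two polynomial inequalities with an explicit factor
  `(K^{n−2} − K^{r−1})` resp. `(K^{n−2} − K^{r−2})` (`core_sn`, `core_sgn`).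
* **The Theorem** (`nazarov2023_rank_matMulTensor_ge_holds`): cases `n = 2` from
  `nazarov2023_rank_matMulTensor_ge_n2`, cases `n ≥ 3` from `nazarov2023_rank_matMulTensor_ge_of_count`
  fed with Lemma 2 in the form `b · R_r ≤ a · v*_r`, `a/b = f(K,n,s)`.

## References

* A. A. Nazarov, *O nizhnei otsenke bilineinoi slozhnosti umnozheniya matrits nad konechnym polem*,
  Vestn. Mosk. Univ. Ser. 15 Vychisl. Mat. Kibern. 2023, no. 4, 41–53 (transl. Mosc. Univ. Comput.
  Math. Cybern. 47 (4) (2023) 218–231): Theorem p. 42, Lemma 1 p. 43, Lemma 2 pp. 44–47, proof of the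
  Theorem p. 49. [Nazarov2023FiniteFieldLB]
* H. Cohn, Amer. Math. Monthly 111 (2004) 487–495, Thm. 1 (the subspace count). [Cohn2004]
-/

noncomputable section

open Module Submodule Finset Matrix
open scoped Classical

namespace Literature.Computability.AlgebraicComplexity

namespace Nazarov2023

open Literature.Combinatorics.Enumerative Literature.LinearAlgebra.Subspace Literature.LinearAlgebra.Matrix

variable {F : Type*} [Field F]

/-! ## Appending a row: `rank [A; v] = rank A + [v ∉ rows A]` -/

section SnocRow

variable {k σ : ℕ}

/-- The matrix `A` with the row `v` appended (as the last row). [cite: Nazarov2023FiniteFieldLB, Lemma 2 (proof: the matrix `L` and its last row `L_n`)] -/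
def snocRow (A : Matrix (Fin k) (Fin σ) F) (v : Fin σ → F) : Matrix (Fin (k + 1)) (Fin σ) F :=
  Matrix.of (Fin.snoc (α := fun _ => Fin σ → F) A v)

omit [Field F] in
/-- The first rows of `[A; v]` are those of `A`. [cite: Nazarov2023FiniteFieldLB, Lemma 2 (proof)] -/
@[simp] theorem snocRow_castSucc (A : Matrix (Fin k) (Fin σ) F) (v : Fin σ → F) (i : Fin k) :
    snocRow A v i.castSucc = A i := by
  change Fin.snoc (α := fun _ => Fin σ → F) A v i.castSucc = A i
  exact Fin.snoc_castSucc (α := fun _ => Fin σ → F) _ _ _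

omit [Field F] in
/-- The last row of `[A; v]` is `v`. [cite: Nazarov2023FiniteFieldLB, Lemma 2 (proof)] -/
@[simp] theorem snocRow_last (A : Matrix (Fin k) (Fin σ) F) (v : Fin σ → F) :
    snocRow A v (Fin.last k) = v := by
  change Fin.snoc (α := fun _ => Fin σ → F) A v (Fin.last k) = v
  exact Fin.snoc_last (α := fun _ => Fin σ → F) _ _

omit [Field F] in
/-- The rows of `[A; v]`. [cite: Nazarov2023FiniteFieldLB, Lemma 2 (proof)] -/
theorem range_snocRow_row (A : Matrix (Fin k) (Fin σ) F) (v : Fin σ → F) :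
    Set.range (snocRow A v).row = insert v (Set.range A.row) := by
  rw [snocRow, Matrix.of_row, Fin.range_snoc]
  rfl

/-- The row space of `[A; v]`. [cite: Nazarov2023FiniteFieldLB, Lemma 2 (proof)] -/
theorem span_snocRow (A : Matrix (Fin k) (Fin σ) F) (v : Fin σ → F) :
    span F (Set.range (snocRow A v).row) = span F (Set.range A.row) ⊔ (F ∙ v) := by
  rw [range_snocRow_row, Submodule.span_insert, sup_comm]

/-- `rank [A; v] = rank A` when `v` is a combination of the rows of `A`. [cite: Nazarov2023FiniteFieldLB, Lemma 2 (proof)] -/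
theorem rank_snocRow_of_mem (A : Matrix (Fin k) (Fin σ) F) {v : Fin σ → F}
    (hv : v ∈ span F (Set.range A.row)) : (snocRow A v).rank = A.rank := by
  rw [Matrix.rank_eq_finrank_span_row, Matrix.rank_eq_finrank_span_row, span_snocRow,
    sup_eq_left.2 ((Submodule.span_singleton_le_iff_mem _ _).2 hv)]

/-- `rank [A; v] = rank A + 1` when `v` is not a combination of the rows of `A`.
[cite: Nazarov2023FiniteFieldLB, Lemma 2 (proof)] -/
theorem rank_snocRow_of_not_mem (A : Matrix (Fin k) (Fin σ) F) {v : Fin σ → F}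
    (hv : v ∉ span F (Set.range A.row)) : (snocRow A v).rank = A.rank + 1 := by
  rw [Matrix.rank_eq_finrank_span_row, Matrix.rank_eq_finrank_span_row, span_snocRow]
  exact Submodule.finrank_sup_span_singleton hv

/-- The row space is unchanged by an invertible row operation `A ↦ P A` ("these operations do not change
the rank and preserve the basis"). [cite: Nazarov2023FiniteFieldLB, Lemma 2 (proof, the row operations of the `M*` correspondence)] -/
theorem span_rows_gl_mul (P : GL (Fin k) F) (A : Matrix (Fin k) (Fin σ) F) :
    span F (Set.range ((P : Matrix (Fin k) (Fin k) F) * A).row) = span F (Set.range A.row) := by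
  rw [← range_vecMulLinear, ← range_vecMulLinear]
  have hc : ((P : Matrix (Fin k) (Fin k) F) * A).vecMulLinear =
      A.vecMulLinear.comp (P : Matrix (Fin k) (Fin k) F).vecMulLinear := by
    apply LinearMap.ext
    intro x
    simp only [Matrix.vecMulLinear_apply, LinearMap.comp_apply, Matrix.vecMul_vecMul]
  rw [hc, LinearMap.range_comp_of_range_eq_top]
  rw [LinearMap.range_eq_top]
  intro y
  refine ⟨y ᵥ* ((P⁻¹ : GL (Fin k) F) : Matrix (Fin k) (Fin k) F), ?_⟩
  simp only [Matrix.vecMulLinear_apply, Matrix.vecMul_vecMul]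
  rw [show ((P⁻¹ : GL (Fin k) F) : Matrix (Fin k) (Fin k) F) * (P : Matrix (Fin k) (Fin k) F) = 1 by
    rw [← Units.val_mul, inv_mul_cancel, Units.val_one], Matrix.vecMul_one]

/-- `rank [P A; v] = rank [A; v]` for invertible `P`. [cite: Nazarov2023FiniteFieldLB, Lemma 2 (proof: "these operations do not change the rank and preserve the basis")] -/
theorem rank_snocRow_gl_mul (P : GL (Fin k) F) (A : Matrix (Fin k) (Fin σ) F) (v : Fin σ → F) :
    (snocRow ((P : Matrix (Fin k) (Fin k) F) * A) v).rank = (snocRow A v).rank := by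
  rw [Matrix.rank_eq_finrank_span_row, Matrix.rank_eq_finrank_span_row, span_snocRow, span_snocRow,
    span_rows_gl_mul]

end SnocRow

/-! ## Counting `(n−2) × (s−1)` matrices of given rank whose rows span a fixed nonzero vector -/

section CountRowSpace

variable [Fintype F] {p σ : ℕ}

/-- Transposition identifies `{N ∈ F^{p×σ} : rank N = t, w ∈ rows N}` with
`{M ∈ F^{σ×p} : rank M = t, w ∈ colSpace M}`. [folklore] -/
private def transposeEquiv (w : Fin σ → F) (t : ℕ) :
    {N : Matrix (Fin p) (Fin σ) F // N.rank = t ∧ w ∈ span F (Set.range N.row)} ≃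
      {M : Matrix (Fin σ) (Fin p) F // M.rank = t ∧ w ∈ colSpace M} where
  toFun N := ⟨N.1ᵀ, by rw [Matrix.rank_transpose]; exact ⟨N.2.1, by rw [colSpace, Matrix.col_transpose]; exact N.2.2⟩⟩
  invFun M := ⟨M.1ᵀ, by
    rw [Matrix.rank_transpose]
    refine ⟨M.2.1, ?_⟩
    have h := M.2.2
    rw [colSpace] at h
    rw [show (M.1ᵀ).row = M.1.col from rfl]
    exact h⟩
  left_inv N := by apply Subtype.ext; exact Matrix.transpose_transpose _
  right_inv M := by apply Subtype.ext; exact Matrix.transpose_transpose _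

/-- The number of `p × σ` matrices of rank `t` is `[σ choose t]_q ∏_{i<t} (q^p − q^i)` (Lemma 1 in the
transposed form). [cite: Nazarov2023FiniteFieldLB, Lemma 1] -/
theorem card_rank_eq' (p σ t : ℕ) :
    (Nat.card {N : Matrix (Fin p) (Fin σ) F // N.rank = t} : ℤ) =
      qBinomial (Fintype.card F : ℤ) σ t * ∏ i ∈ range t, ((Fintype.card F : ℤ) ^ p - (Fintype.card F : ℤ) ^ i) := by
  rw [← card_rank_eq_qBinomial_mul_prod σ p t]
  refine congrArg _ (Nat.card_congr ?_)
  exact { toFun := fun N => ⟨N.1ᵀ, by rw [Matrix.rank_transpose]; exact N.2⟩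
          invFun := fun M => ⟨M.1ᵀ, by rw [Matrix.rank_transpose]; exact M.2⟩
          left_inv := fun N => Subtype.ext (Matrix.transpose_transpose _)
          right_inv := fun M => Subtype.ext (Matrix.transpose_transpose _) }

/-- The `(u+1)`-dimensional subspaces of `F^σ` through a nonzero vector number `[σ−1 choose u]_q`
(Cohn's count of the subspaces containing a line). [cite: Cohn2004, Thm. 1] -/
theorem card_subspaces_mem_eq (w : Fin σ → F) (hw : w ≠ 0) (u : ℕ) (hu : u + 1 ≤ σ) :
    (Nat.card {W : Submodule F (Fin σ → F) // finrank F W = u + 1 ∧ w ∈ W} : ℤ) =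
      qBinomial (Fintype.card F : ℤ) (σ - 1) u := by
  have h1 : finrank F (F ∙ w) = 1 := finrank_span_singleton hw
  have h := card_ge_codim_eq_qBinomial (F ∙ w) (σ - (u + 1))
  rw [finrank_fin_fun, h1, Nat.card_eq_fintype_card (α := F)] at h
  rw [show σ - (u + 1) = (σ - 1) - u by omega, qBinomial_symm _ (by omega : u ≤ σ - 1)] at h
  rw [← h]
  refine congrArg _ (Nat.card_congr (Equiv.subtypeEquivRight fun W => ?_))
  rw [Submodule.span_singleton_le_iff_mem]
  have hW : finrank F W ≤ σ := by
    have := Submodule.finrank_le W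
    rwa [finrank_fin_fun] at this
  constructor
  · rintro ⟨hd, hm⟩
    exact ⟨hm, by omega⟩
  · rintro ⟨hm, hd⟩
    exact ⟨by omega, hm⟩

/-- **The `α`-count of Lemma 2**: the `p × σ` matrices of rank `u + 1` whose rows express a fixed nonzero
vector `w` number `[σ−1 choose u]_q · ∏_{i ≤ u} (q^p − q^i)` (against `[σ choose u+1]_q ∏ (⋯)` in all:
"the share … equals `α = (K^{r−1} − 1)/(K^{s−1} − 1)`"). [cite: Nazarov2023FiniteFieldLB, Lemma 2 (proof, the computation of `α`)] -/
theorem card_rank_eq_and_mem (w : Fin σ → F) (hw : w ≠ 0) (u : ℕ) (hu : u + 1 ≤ σ) :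
    (Nat.card {N : Matrix (Fin p) (Fin σ) F // N.rank = u + 1 ∧ w ∈ span F (Set.range N.row)} : ℤ) =
      qBinomial (Fintype.card F : ℤ) (σ - 1) u *
        ∏ i ∈ range (u + 1), ((Fintype.card F : ℤ) ^ p - (Fintype.card F : ℤ) ^ i) := by
  rw [Nat.card_congr (transposeEquiv w (u + 1))]
  rcases le_or_gt (u + 1) p with hup | hup
  · -- fibration by the column space
    have e : {M : Matrix (Fin σ) (Fin p) F // M.rank = u + 1 ∧ w ∈ colSpace M} ≃
        Σ _ : {W : Submodule F (Fin σ → F) // finrank F W = u + 1 ∧ w ∈ W},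
          {g : Fin (u + 1) → (Fin p → F) // LinearIndependent F g} :=
      { toFun := fun M => ⟨⟨colSpace M.1, by
            refine ⟨?_, M.2.2⟩
            change finrank F (span F (Set.range M.1.col)) = u + 1
            rw [← Matrix.rank_eq_finrank_span_cols]
            exact M.2.1⟩,
          ⟨M.1, rfl⟩⟩
        invFun := fun q => ⟨q.2.1, by
          refine ⟨?_, ?_⟩
          · rw [Matrix.rank_eq_finrank_span_cols]
            change finrank F (colSpace q.2.1) = u + 1
            rw [q.2.2]; exact q.1.2.1
          · have h := q.1.2.2
            rw [← q.2.2] at h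
            exact h⟩
        left_inv := fun M => rfl
        right_inv := fun q => by
          cases q with | mk W' A' => ?_
          cases W' with | mk W hW => ?_
          cases A' with | mk A hA => ?_
          change colSpace A = W at hA
          subst hA
          rfl : {M : Matrix (Fin σ) (Fin p) F // M.rank = u + 1 ∧ w ∈ colSpace M} ≃
          Σ W : {W : Submodule F (Fin σ → F) // finrank F W = u + 1 ∧ w ∈ W},
            {A : Matrix (Fin σ) (Fin p) F // colSpace A = W.1} }.trans
        (Equiv.sigmaCongrRight fun W =>
          (fibreEquiv W.1).trans (spanningEquiv (s := p) (finBasisOfFinrankEq F W.1 W.2.1)))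
    rw [Nat.card_congr (e.trans (Equiv.sigmaEquivProd _ _)), Nat.card_prod, Nat.cast_mul,
      card_subspaces_mem_eq w hw u hu,
      card_linearIndependent (K := F) (V := Fin p → F) (by rw [finrank_fin_fun]; exact hup),
      finrank_fin_fun, Fin.prod_univ_eq_prod_range (fun i => Fintype.card F ^ p - Fintype.card F ^ i) (u + 1),
      Nat.cast_prod]
    refine congrArg _ (Finset.prod_congr rfl fun i hi => ?_)
    have hi' : i < u + 1 := Finset.mem_range.1 hi
    rw [Nat.cast_sub (Nat.pow_le_pow_right Fintype.card_pos (by omega))]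
    push_cast
    ring
  · -- `u + 1 > p`: no such matrix, and the factor `i = p` vanishes
    have h0 : Nat.card {M : Matrix (Fin σ) (Fin p) F // M.rank = u + 1 ∧ w ∈ colSpace M} = 0 := by
      rw [Nat.card_eq_zero]
      left
      refine ⟨fun M => ?_⟩
      have h1 := Matrix.rank_le_width M.1
      have h2 := M.2.1
      have h3 : Fintype.card (Fin p) = p := Fintype.card_fin p
      omega
    rw [h0, Nat.cast_zero, Finset.prod_eq_zero (Finset.mem_range.2 hup) (by ring), mul_zero]

omit [Fintype F] in
/-- For `w ≠ 0` no matrix of rank `0` has `w` in its row space (the share `α` vanishes at rank `0`: the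
rank-one matrices of `L*` all have `D = 0`). [cite: Nazarov2023FiniteFieldLB, Lemma 2 (proof, the case `r = 1`)] -/
theorem card_rank_zero_and_mem (w : Fin σ → F) (hw : w ≠ 0) :
    Nat.card {N : Matrix (Fin p) (Fin σ) F // N.rank = 0 ∧ w ∈ span F (Set.range N.row)} = 0 := by
  rw [Nat.card_eq_zero]
  left
  refine ⟨fun N => hw ?_⟩
  obtain ⟨hr, hm⟩ := N.2
  rw [Matrix.rank_eq_finrank_span_row, Submodule.finrank_eq_zero] at hr
  rw [hr] at hm
  exact (Submodule.mem_bot F).1 hm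

end CountRowSpace

/-! ## The last column, padding by a zero coordinate, and the normal form `M*` (last column `e₀`) -/

section NormalForm

variable {p σ : ℕ}

/-- The last column of a `(p+1) × (σ+1)` matrix (the vector `D` of the source).
[cite: Nazarov2023FiniteFieldLB, Lemma 2 (proof, `D = [d₁, …, d_{n−1}]`)] -/
def lastColV (C : Matrix (Fin (p + 1)) (Fin (σ + 1)) F) : Fin (p + 1) → F := fun i => C i (Fin.last σ)

/-- Padding a row of length `σ` by a final `0`. [cite: Nazarov2023FiniteFieldLB, Lemma 2 (proof, "drop the last zero column")] -/
def padZero : (Fin σ → F) →ₗ[F] (Fin (σ + 1) → F) where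
  toFun y := Fin.snoc (α := fun _ => F) y 0
  map_add' y z := by
    ext j
    refine Fin.lastCases ?_ (fun j => ?_) j
    · simp
    · simp
  map_smul' c y := by
    ext j
    refine Fin.lastCases ?_ (fun j => ?_) j
    · simp
    · simp

/-- `padZero y` on the first coordinates. [cite: Nazarov2023FiniteFieldLB, Lemma 2 (proof)] -/
@[simp] theorem padZero_castSucc (y : Fin σ → F) (j : Fin σ) : padZero y j.castSucc = y j := by
  simp [padZero]

/-- `padZero y` vanishes on the last coordinate. [cite: Nazarov2023FiniteFieldLB, Lemma 2 (proof)] -/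
@[simp] theorem padZero_last (y : Fin σ → F) : padZero y (Fin.last σ) = 0 := by
  simp [padZero]

/-- `padZero` is injective. [cite: Nazarov2023FiniteFieldLB, Lemma 2 (proof)] -/
theorem padZero_injective : Function.Injective (padZero (F := F) (σ := σ)) := by
  intro y z h
  funext j
  have := congrFun h j.castSucc
  simpa using this

/-- Everything in the image of `padZero` has last coordinate `0`. [cite: Nazarov2023FiniteFieldLB, Lemma 2 (proof)] -/
theorem apply_last_eq_zero_of_mem_map {S : Submodule F (Fin σ → F)} {x : Fin (σ + 1) → F}
    (hx : x ∈ S.map (padZero (F := F))) : x (Fin.last σ) = 0 := by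
  obtain ⟨y, -, rfl⟩ := Submodule.mem_map.1 hx
  exact padZero_last y

/-- `dim (pad S) = dim S`. [cite: Nazarov2023FiniteFieldLB, Lemma 2 (proof)] -/
theorem finrank_map_padZero (S : Submodule F (Fin σ → F)) :
    finrank F (S.map (padZero (F := F))) = finrank F S :=
  (LinearEquiv.finrank_eq (Submodule.equivMapOfInjective _ padZero_injective S)).symm

/-- `e₀ = (1, 0, …, 0)ᵀ`, the normalised last column of the source's family `M*`.
[cite: Nazarov2023FiniteFieldLB, Lemma 2 (proof, the matrices `M = [Y 1; N O]`)] -/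
def e0 : Fin (p + 1) → F := Pi.single 0 1

/-- The parametrisation of `M* = {C : last column = e₀}` by `(Y, N)`: `C = [Y 1; N 0]`.
[cite: Nazarov2023FiniteFieldLB, Lemma 2 (proof, `M = [Y 1; N O]`)] -/
def normalEquiv : {C : Matrix (Fin (p + 1)) (Fin (σ + 1)) F // lastColV C = e0} ≃
    (Fin σ → F) × Matrix (Fin p) (Fin σ) F where
  toFun C := (fun j => C.1 0 j.castSucc, fun i j => C.1 i.succ j.castSucc)
  invFun YN := ⟨Matrix.of (Fin.cons (α := fun _ => Fin (σ + 1) → F) (Fin.snoc (α := fun _ => F) YN.1 1)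
      (fun i => padZero (YN.2 i))), by
    funext i
    refine Fin.cases ?_ (fun i => ?_) i
    · simp [lastColV, e0]
    · simp [lastColV, e0, Fin.succ_ne_zero]⟩
  left_inv C := by
    apply Subtype.ext
    ext i j
    refine Fin.cases ?_ (fun i => ?_) i
    · refine Fin.lastCases ?_ (fun j => ?_) j
      · have h := congrFun C.2 0
        simp only [lastColV, e0, Pi.single_eq_same] at h
        simp [h]
      · simp
    · refine Fin.lastCases ?_ (fun j => ?_) j
      · have h := congrFun C.2 i.succ
        simp only [lastColV, e0, Pi.single_eq_of_ne (Fin.succ_ne_zero i)] at h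
        simp [h]
      · simp
  right_inv YN := by
    ext
    · simp
    · simp

/-- Row `0` of a matrix of `M*` is `(Y, 1)`. [cite: Nazarov2023FiniteFieldLB, Lemma 2 (proof)] -/
theorem row_zero_eq (C : {C : Matrix (Fin (p + 1)) (Fin (σ + 1)) F // lastColV C = e0}) :
    C.1 0 = Fin.snoc (α := fun _ => F) (normalEquiv C).1 1 := by
  funext j
  refine Fin.lastCases ?_ (fun j => ?_) j
  · have h := congrFun C.2 0
    simp only [lastColV, e0, Pi.single_eq_same] at h
    simp [h]
  · simp [normalEquiv]

/-- Row `i + 1` of a matrix of `M*` is `(N_i, 0)`. [cite: Nazarov2023FiniteFieldLB, Lemma 2 (proof)] -/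
theorem row_succ_eq (C : {C : Matrix (Fin (p + 1)) (Fin (σ + 1)) F // lastColV C = e0}) (i : Fin p) :
    C.1 i.succ = padZero ((normalEquiv C).2 i) := by
  funext j
  refine Fin.lastCases ?_ (fun j => ?_) j
  · have h := congrFun C.2 i.succ
    simp only [lastColV, e0, Pi.single_eq_of_ne (Fin.succ_ne_zero i)] at h
    simp [h]
  · simp [normalEquiv]

/-- **The reduction step of Lemma 2**: for `C = [Y 1; N 0] ∈ M*` and a row `w` with last coordinate `0`,
`rank [C; (w,0)] = rank [N; w] + 1` ("the first row cannot enter the combination … drop it, drop the last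
zero column"). [cite: Nazarov2023FiniteFieldLB, Lemma 2 (proof, from `M*` to `N*`)] -/
theorem rank_snocRow_normal (C : {C : Matrix (Fin (p + 1)) (Fin (σ + 1)) F // lastColV C = e0})
    (w : Fin σ → F) :
    (snocRow C.1 (padZero w)).rank = (snocRow (normalEquiv C).2 w).rank + 1 := by
  set Y := (normalEquiv C).1 with hY
  set N := (normalEquiv C).2 with hN
  rw [Matrix.rank_eq_finrank_span_row, Matrix.rank_eq_finrank_span_row, range_snocRow_row,
    range_snocRow_row]
  -- the rows of `C`: `(Y,1)` and the padded rows of `N`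
  have hrows : Set.range C.1.row = insert (C.1 0) (padZero '' Set.range N.row) := by
    rw [Matrix.row_def, show (fun i => C.1 i) = Fin.cons (α := fun _ => Fin (σ + 1) → F) (C.1 0)
      (fun i => C.1 i.succ) from (Fin.cons_self_tail _).symm, Fin.range_cons, ← Set.range_comp]
    congr 1
    apply congrArg Set.range
    funext i
    exact row_succ_eq C i
  rw [hrows, Set.insert_comm, Submodule.span_insert, ← Set.image_insert_eq, ← Submodule.map_span,
    Matrix.row_def]
  -- `(Y, 1) ∉ pad (…)` by the last coordinate
  have hnot : C.1 0 ∉ (span F (insert w (Set.range fun i => N i))).map (padZero (F := F)) := by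
    intro h
    have h1 := apply_last_eq_zero_of_mem_map h
    rw [row_zero_eq C, Fin.snoc_last] at h1
    exact one_ne_zero h1
  rw [sup_comm, Submodule.finrank_sup_span_singleton hnot, finrank_map_padZero]

/-- The count over `M*` factors through `(Y, N)`: `K^σ` choices of `Y`. [cite: Nazarov2023FiniteFieldLB, Lemma 2 (proof, `Y` arbitrary)] -/
theorem card_normal_eq [Fintype F] (w : Fin σ → F) (r : ℕ) :
    Nat.card {C : Matrix (Fin (p + 1)) (Fin (σ + 1)) F // lastColV C = e0 ∧ (snocRow C (padZero w)).rank = r} =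
      Fintype.card F ^ σ * Nat.card {N : Matrix (Fin p) (Fin σ) F // (snocRow N w).rank + 1 = r} := by
  have e : {C : Matrix (Fin (p + 1)) (Fin (σ + 1)) F // lastColV C = e0 ∧ (snocRow C (padZero w)).rank = r} ≃
      (Fin σ → F) × {N : Matrix (Fin p) (Fin σ) F // (snocRow N w).rank + 1 = r} :=
    ((Equiv.subtypeSubtypeEquivSubtypeInter (fun C => lastColV C = e0)
        (fun C => (snocRow C (padZero w)).rank = r)).symm.trans
      (Equiv.subtypeEquiv (p := fun C : {C : Matrix (Fin (p + 1)) (Fin (σ + 1)) F // lastColV C = e0} =>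
          (snocRow C.1 (padZero w)).rank = r)
        (q := fun YN : (Fin σ → F) × Matrix (Fin p) (Fin σ) F => (snocRow YN.2 w).rank + 1 = r)
        normalEquiv (fun C => by
          change (snocRow C.1 (padZero w)).rank = r ↔ (snocRow (normalEquiv C).2 w).rank + 1 = r
          rw [rank_snocRow_normal]))).trans
      { toFun := fun x => (x.1.1, ⟨x.1.2, x.2⟩)
        invFun := fun y => ⟨(y.1, y.2.1), y.2.2⟩
        left_inv := fun x => rfl
        right_inv := fun y => rfl }
  rw [Nat.card_congr e, Nat.card_prod, Nat.card_eq_fintype_card, Fintype.card_fun, Fintype.card_fin]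

end NormalForm

/-! ## Normalising a nonzero last column `D` to `e₀` by an invertible row operation -/

section MoveD

variable {p σ : ℕ}

/-- The last column of `P C` is `P D`. [folklore] -/
private theorem lastColV_mul (P : Matrix (Fin (p + 1)) (Fin (p + 1)) F) (C : Matrix (Fin (p + 1)) (Fin (σ + 1)) F) :
    lastColV (P * C) = P *ᵥ lastColV C := by
  funext i
  simp [lastColV, Matrix.mul_apply, Matrix.mulVec, dotProduct]

/-- For `D ≠ 0` there is an invertible `P` with `P D = e₀` (`GL` is transitive on nonzero vectors).
[cite: Nazarov2023FiniteFieldLB, Lemma 2 (proof, the row operations sending the last column `D` to `(1,0,…,0)ᵀ`)] -/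
theorem exists_gl_mulVec_eq_e0 {D : Fin (p + 1) → F} (hD : D ≠ 0) :
    ∃ P : GL (Fin (p + 1)) F, (P : Matrix (Fin (p + 1)) (Fin (p + 1)) F) *ᵥ D = e0 := by
  have he : (e0 : Fin (p + 1) → F) ≠ 0 := by
    intro h
    have := congrFun h 0
    simp [e0] at this
  obtain ⟨θ, hθ⟩ := exists_equiv_comp_eq (LinearMap.toSpanSingleton F _ D) (LinearMap.toSpanSingleton F _ e0)
    (fun a b hab => smul_left_injective F hD hab) (fun a b hab => smul_left_injective F he hab)
  refine ⟨glOfLinearEquiv θ, ?_⟩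
  have h1 := hθ 1
  simp only [LinearMap.toSpanSingleton_apply, one_smul] at h1
  rw [← h1]
  simp [glOfLinearEquiv, Matrix.GeneralLinearGroup.val_mkOfDetNeZero, LinearMap.toMatrix'_mulVec]

/-- Left multiplication by an invertible matrix, as a permutation of `F^{(p+1)×(σ+1)}`. [folklore] -/
def mulLeftEquiv (P : GL (Fin (p + 1)) F) :
    Matrix (Fin (p + 1)) (Fin (σ + 1)) F ≃ Matrix (Fin (p + 1)) (Fin (σ + 1)) F where
  toFun C := (P : Matrix (Fin (p + 1)) (Fin (p + 1)) F) * C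
  invFun C := ((P⁻¹ : GL (Fin (p + 1)) F) : Matrix (Fin (p + 1)) (Fin (p + 1)) F) * C
  left_inv C := by
    simp only
    rw [← Matrix.mul_assoc, ← Units.val_mul, inv_mul_cancel, Units.val_one, Matrix.one_mul]
  right_inv C := by
    simp only
    rw [← Matrix.mul_assoc, ← Units.val_mul, mul_inv_cancel, Units.val_one, Matrix.one_mul]

/-- **Normalisation**: the count with prescribed last column `D ≠ 0` equals the count over `M*`
("to each matrix of `F_r^{(n−1,s)}` with nonzero last column corresponds exactly one matrix of `M*`").
[cite: Nazarov2023FiniteFieldLB, Lemma 2 (proof, the bijection with `M*`)] -/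
theorem card_lastColV_eq_card_e0 [Fintype F] {D : Fin (p + 1) → F} (hD : D ≠ 0) (w : Fin (σ + 1) → F) (r : ℕ) :
    Nat.card {C : Matrix (Fin (p + 1)) (Fin (σ + 1)) F // lastColV C = D ∧ (snocRow C w).rank = r} =
      Nat.card {C : Matrix (Fin (p + 1)) (Fin (σ + 1)) F // lastColV C = e0 ∧ (snocRow C w).rank = r} := by
  obtain ⟨P, hP⟩ := exists_gl_mulVec_eq_e0 hD
  refine Nat.card_congr (Equiv.subtypeEquiv (mulLeftEquiv P) fun C => ?_)
  change _ ↔ lastColV ((P : Matrix (Fin (p + 1)) (Fin (p + 1)) F) * C) = e0 ∧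
    (snocRow ((P : Matrix (Fin (p + 1)) (Fin (p + 1)) F) * C) w).rank = r
  rw [rank_snocRow_gl_mul, lastColV_mul, ← hP]
  constructor
  · rintro ⟨h1, h2⟩
    exact ⟨by rw [h1], h2⟩
  · rintro ⟨h1, h2⟩
    refine ⟨?_, h2⟩
    have h3 := congrArg (fun v => ((P⁻¹ : GL (Fin (p + 1)) F) : Matrix (Fin (p + 1)) (Fin (p + 1)) F) *ᵥ v) h1
    simp only [Matrix.mulVec_mulVec] at h3
    rwa [← Units.val_mul, inv_mul_cancel, Units.val_one, Matrix.one_mulVec, Matrix.one_mulVec] at h3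

end MoveD

/-! ## `L*` is parametrised by the first `n − 1` rows; the last row is `L_n = (−D, 0)` -/

section LStar

variable {p σ : ℕ}

/-- The last row `L_n = (−d₁, …, −d_{n−1}, 0, …, 0)` of a matrix of `L*`, as a function of the last
column `D` of its first `n − 1` rows. [cite: Nazarov2023FiniteFieldLB, Lemma 2 (proof, the matrix `L`)] -/
def wD (D : Fin (p + 1) → F) : Fin (σ + 1) → F := fun c => if h : c.val < p + 1 then -D ⟨c.val, h⟩ else 0

/-- `L'_n`: the row `L_n` without its last (zero) coordinate. [cite: Nazarov2023FiniteFieldLB, Lemma 2 (proof, "the vector `L_n` without the last `0`")] -/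
def wD' (D : Fin (p + 1) → F) : Fin σ → F := fun c => if h : c.val < p + 1 then -D ⟨c.val, h⟩ else 0

/-- `L_n = (L'_n, 0)` (this uses `n ≤ s`). [cite: Nazarov2023FiniteFieldLB, Lemma 2 (proof)] -/
theorem wD_eq_padZero (hps : p + 1 ≤ σ) (D : Fin (p + 1) → F) : wD D = padZero (wD' (σ := σ) D) := by
  funext c
  refine Fin.lastCases ?_ (fun j => ?_) c
  · rw [padZero_last]
    simp only [wD, Fin.val_last]
    rw [dif_neg (by omega)]
  · rw [padZero_castSucc]
    simp only [wD, wD', Fin.val_castSucc]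

/-- `L'_n ≠ 0` when `D ≠ 0` (again as `n ≤ s`). [cite: Nazarov2023FiniteFieldLB, Lemma 2 (proof)] -/
theorem wD'_ne_zero (hps : p + 1 ≤ σ) {D : Fin (p + 1) → F} (hD : D ≠ 0) : wD' (σ := σ) D ≠ 0 := by
  intro h
  apply hD
  funext i
  have hi := congrFun h ⟨i.val, by omega⟩
  simp only [wD', i.isLt, dif_pos, Fin.eta, Pi.zero_apply, neg_eq_zero] at hi
  exact hi

/-- `L_n = 0` when `D = 0`. [cite: Nazarov2023FiniteFieldLB, Lemma 2 (proof, the case of a zero `D`)] -/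
theorem wD_zero : wD (0 : Fin (p + 1) → F) = (0 : Fin (σ + 1) → F) := by
  funext c
  simp [wD]

/-- The last row index of `MatMul2smRankFiniteField.rowL` is `Fin.last`. [folklore] -/
private theorem rowL_eq (h : 1 ≤ p + 2) : rowL h = Fin.last (p + 1) := Fin.ext (by simp [rowL])

/-- The last column index of `MatMul2smRankFiniteField.colL` is `Fin.last`. [folklore] -/
private theorem colL_eq (h : 1 ≤ σ + 1) : colL h = Fin.last σ := Fin.ext (by simp [colL])

/-- The first `n − 1` rows. [cite: Nazarov2023FiniteFieldLB, Lemma 2 (proof, "the matrix `L` is given by the values in its first `n − 1` rows")] -/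
def initRows (M : Matrix (Fin (p + 2)) (Fin (σ + 1)) F) : Matrix (Fin (p + 1)) (Fin (σ + 1)) F :=
  fun i j => M i.castSucc j

/-- Membership in `L*` says: the last row is `L_n = (−D, 0)`. [cite: Nazarov2023FiniteFieldLB, §3 (definition of `L*`) and Lemma 2 (proof)] -/
theorem inL_iff (h1 : 1 ≤ p + 2) (h2 : p + 2 ≤ σ + 1) (M : Matrix (Fin (p + 2)) (Fin (σ + 1)) F) :
    InL h1 h2 M ↔ M (Fin.last (p + 1)) = wD (lastColV (initRows M)) := by
  unfold InL
  rw [rowL_eq, colL_eq]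
  constructor
  · intro h
    funext c
    have hc := h c
    by_cases hlt : c.val < p + 1
    · rw [dif_pos (by omega)] at hc
      simp only [wD, dif_pos hlt, lastColV, initRows]
      have e : (⟨c.val, by omega⟩ : Fin (p + 2)) = (⟨c.val, hlt⟩ : Fin (p + 1)).castSucc := rfl
      rw [e] at hc
      linear_combination hc
    · rw [dif_neg (by omega), add_zero] at hc
      simp only [wD, dif_neg hlt]
      exact hc
  · intro h c
    have hc := congrFun h c
    by_cases hlt : c.val < p + 1
    · rw [dif_pos (by omega)]
      simp only [wD, dif_pos hlt, lastColV, initRows] at hc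
      have e : (⟨c.val, by omega⟩ : Fin (p + 2)) = (⟨c.val, hlt⟩ : Fin (p + 1)).castSucc := rfl
      rw [e, hc]
      ring
    · rw [dif_neg (by omega), add_zero]
      simp only [wD, dif_neg hlt] at hc
      exact hc

/-- A matrix of `L*` is `[C; L_n(C)]` with `C` its first `n − 1` rows. [cite: Nazarov2023FiniteFieldLB, Lemma 2 (proof)] -/
theorem snocRow_initRows {h1 : 1 ≤ p + 2} {h2 : p + 2 ≤ σ + 1} {M : Matrix (Fin (p + 2)) (Fin (σ + 1)) F}
    (hM : InL h1 h2 M) : snocRow (initRows M) (wD (lastColV (initRows M))) = M := by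
  rw [inL_iff] at hM
  ext i j
  refine Fin.lastCases ?_ (fun i => ?_) i
  · rw [snocRow_last, hM]
  · rw [snocRow_castSucc]
    rfl

/-- Conversely every `[C; L_n(C)]` lies in `L*`. [cite: Nazarov2023FiniteFieldLB, Lemma 2 (proof)] -/
theorem inL_snocRow (h1 : 1 ≤ p + 2) (h2 : p + 2 ≤ σ + 1) (C : Matrix (Fin (p + 1)) (Fin (σ + 1)) F) :
    InL h1 h2 (snocRow C (wD (lastColV C))) := by
  rw [inL_iff]
  have e : initRows (snocRow C (wD (lastColV C))) = C := by
    ext i j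
    simp [initRows]
  rw [snocRow_last, e]

/-- **`L*` ≅ `F^{(n−1)×s}`** compatibly with the rank of `[C; L_n(C)]` ("to every matrix of `L*` of rank `r`
corresponds one and only one matrix of `F^{(n−1,s)}`"). [cite: Nazarov2023FiniteFieldLB, Lemma 2 (proof)] -/
def lStarEquiv (h1 : 1 ≤ p + 2) (h2 : p + 2 ≤ σ + 1) (r : ℕ) :
    {M : Matrix (Fin (p + 2)) (Fin (σ + 1)) F // InL h1 h2 M ∧ M.rank = r} ≃
      {C : Matrix (Fin (p + 1)) (Fin (σ + 1)) F // (snocRow C (wD (lastColV C))).rank = r} where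
  toFun M := ⟨initRows M.1, by rw [snocRow_initRows M.2.1]; exact M.2.2⟩
  invFun C := ⟨snocRow C.1 (wD (lastColV C.1)), inL_snocRow h1 h2 C.1, C.2⟩
  left_inv M := Subtype.ext (snocRow_initRows M.2.1)
  right_inv C := by
    apply Subtype.ext
    ext i j
    simp [initRows]

end LStar

/-! ## Assembly of the count `v*_r` (Lemma 2, the formula for `v*_r`) -/

section VStar

variable [Fintype F] {p σ : ℕ}

/-- Splitting the count by the last column `D`. [cite: Nazarov2023FiniteFieldLB, Lemma 2 (proof, `v*_r = X₀ + X_lin + X̄_lin`)] -/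
theorem card_eq_sum_lastColV (r : ℕ) :
    Nat.card {C : Matrix (Fin (p + 1)) (Fin (σ + 1)) F // (snocRow C (wD (lastColV C))).rank = r} =
      ∑ D : Fin (p + 1) → F,
        Nat.card {C : Matrix (Fin (p + 1)) (Fin (σ + 1)) F // lastColV C = D ∧ (snocRow C (wD D)).rank = r} := by
  rw [Nat.card_eq_fintype_card, Fintype.card_subtype,
    Finset.card_eq_sum_card_fiberwise (f := lastColV) (t := Finset.univ) (fun C _ => Finset.mem_univ _)]
  refine Finset.sum_congr rfl fun D _ => ?_
  rw [Nat.card_eq_fintype_card, Fintype.card_subtype, Finset.filter_filter]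
  congr 1
  ext C
  simp only [Finset.mem_filter, Finset.mem_univ, true_and]
  constructor
  · rintro ⟨h1, h2⟩
    subst h2
    exact ⟨rfl, h1⟩
  · rintro ⟨h1, h2⟩
    subst h1
    exact ⟨h2, rfl⟩

omit [Fintype F] in
/-- Padding every row by a final zero (a zero last column). [cite: Nazarov2023FiniteFieldLB, Lemma 2 (proof, `X₀ = R_r^{(n−1,s−1)}`)] -/
def padCols (C' : Matrix (Fin (p + 1)) (Fin σ) F) : Matrix (Fin (p + 1)) (Fin (σ + 1)) F :=
  Matrix.of fun i => padZero (C' i)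

omit [Fintype F] in
/-- Dropping the last column. [cite: Nazarov2023FiniteFieldLB, Lemma 2 (proof, `X₀`)] -/
def initCols (C : Matrix (Fin (p + 1)) (Fin (σ + 1)) F) : Matrix (Fin (p + 1)) (Fin σ) F :=
  fun i j => C i j.castSucc

omit [Fintype F] in
/-- `initCols ∘ padCols = id`. [cite: Nazarov2023FiniteFieldLB, Lemma 2 (proof, `X₀`)] -/
theorem initCols_padCols (C' : Matrix (Fin (p + 1)) (Fin σ) F) : initCols (padCols C') = C' := by
  ext i j
  simp [initCols, padCols]

omit [Fintype F] in
/-- `padCols ∘ initCols = id` on matrices with zero last column. [cite: Nazarov2023FiniteFieldLB, Lemma 2 (proof, `X₀`)] -/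
theorem padCols_initCols {C : Matrix (Fin (p + 1)) (Fin (σ + 1)) F} (hC : lastColV C = 0) :
    padCols (initCols C) = C := by
  ext i j
  refine Fin.lastCases ?_ (fun j => ?_) j
  · have h := congrFun hC i
    simp only [lastColV, Pi.zero_apply] at h
    simp [padCols, h]
  · simp [padCols, initCols]

omit [Fintype F] in
/-- `padCols C'` has zero last column. [cite: Nazarov2023FiniteFieldLB, Lemma 2 (proof, `X₀`)] -/
theorem lastColV_padCols (C' : Matrix (Fin (p + 1)) (Fin σ) F) : lastColV (padCols C') = 0 := by
  funext i
  simp [lastColV, padCols]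

omit [Fintype F] in
/-- Dropping a zero last column does not change the rank. [cite: Nazarov2023FiniteFieldLB, Lemma 2 (proof, `X₀ = R_r^{(n−1,s−1)}`)] -/
theorem rank_padCols (C' : Matrix (Fin (p + 1)) (Fin σ) F) : (padCols C').rank = C'.rank := by
  rw [Matrix.rank_eq_finrank_span_row, Matrix.rank_eq_finrank_span_row, padCols, Matrix.of_row,
    show (fun i => padZero (C' i)) = padZero ∘ C'.row from rfl, Set.range_comp, ← Submodule.map_span,
    finrank_map_padZero]

omit [Fintype F] in
/-- With `D = 0` the last row `L_n` vanishes: `rank [C; 0] = rank C`. [cite: Nazarov2023FiniteFieldLB, Lemma 2 (proof, `X₀`)] -/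
theorem rank_snocRow_wD_zero (C : Matrix (Fin (p + 1)) (Fin (σ + 1)) F) :
    (snocRow C (wD (0 : Fin (p + 1) → F))).rank = C.rank := by
  rw [wD_zero]
  exact rank_snocRow_of_mem _ (Submodule.zero_mem _)

omit [Fintype F] in
/-- **The case `D = 0`**: `X₀ = R_r^{(n−1,s−1)}`. [cite: Nazarov2023FiniteFieldLB, Lemma 2 (proof, `X₀`)] -/
theorem card_fibre_zero (r : ℕ) :
    Nat.card {C : Matrix (Fin (p + 1)) (Fin (σ + 1)) F //
        lastColV C = 0 ∧ (snocRow C (wD (0 : Fin (p + 1) → F))).rank = r} =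
      Nat.card {C' : Matrix (Fin (p + 1)) (Fin σ) F // C'.rank = r} :=
  Nat.card_congr
    { toFun := fun C => ⟨initCols C.1, by
        rw [← rank_padCols, padCols_initCols C.2.1, ← rank_snocRow_wD_zero]
        exact C.2.2⟩
      invFun := fun C' => ⟨padCols C'.1, lastColV_padCols _, by
        rw [rank_snocRow_wD_zero, rank_padCols]
        exact C'.2⟩
      left_inv := fun C => Subtype.ext (padCols_initCols C.2.1)
      right_inv := fun C' => Subtype.ext (initCols_padCols C'.1) }

/-- **The case `D ≠ 0`**, reduced to `N*`: `K^{s−1} · #{N ∈ F^{(n−2)×(s−1)} : rank [N; L'_n] + 1 = r}`.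
[cite: Nazarov2023FiniteFieldLB, Lemma 2 (proof, from `M*` to `N*`)] -/
theorem card_fibre_ne_zero (hps : p + 1 ≤ σ) {D : Fin (p + 1) → F} (hD : D ≠ 0) (r : ℕ) :
    Nat.card {C : Matrix (Fin (p + 1)) (Fin (σ + 1)) F // lastColV C = D ∧ (snocRow C (wD D)).rank = r} =
      Fintype.card F ^ σ * Nat.card {N : Matrix (Fin p) (Fin σ) F // (snocRow N (wD' (σ := σ) D)).rank + 1 = r} := by
  rw [card_lastColV_eq_card_e0 hD, wD_eq_padZero hps, card_normal_eq]

/-- `#{N : rank [N; w] = u + 1}` split by `w ∈ rows N`. [cite: Nazarov2023FiniteFieldLB, Lemma 2 (proof, the shares `α` and `β`)] -/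
theorem card_rank_snocRow (w : Fin σ → F) (u : ℕ) :
    Nat.card {N : Matrix (Fin p) (Fin σ) F // (snocRow N w).rank = u + 1} =
      Nat.card {N : Matrix (Fin p) (Fin σ) F // N.rank = u + 1 ∧ w ∈ span F (Set.range N.row)} +
        Nat.card {N : Matrix (Fin p) (Fin σ) F // N.rank = u ∧ w ∉ span F (Set.range N.row)} := by
  rw [Nat.card_eq_fintype_card, Nat.card_eq_fintype_card, Nat.card_eq_fintype_card, Fintype.card_subtype,
    Fintype.card_subtype, Fintype.card_subtype, ← Finset.card_union_of_disjoint]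
  · congr 1
    ext N
    simp only [Finset.mem_union, Finset.mem_filter, Finset.mem_univ, true_and]
    by_cases hw : w ∈ span F (Set.range N.row)
    · rw [rank_snocRow_of_mem _ hw]
      simp [hw]
    · rw [rank_snocRow_of_not_mem _ hw]
      simp [hw]
  · rw [Finset.disjoint_filter]
    intro N _ h1 h2
    exact h2.2 h1.2

/-- `#{N : rank N = u, w ∉ rows N} + #{N : rank N = u, w ∈ rows N} = R_u`. [cite: Nazarov2023FiniteFieldLB, Lemma 2 (proof, `β = 1 − …`)] -/
theorem card_rank_not_mem_add (w : Fin σ → F) (u : ℕ) :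
    Nat.card {N : Matrix (Fin p) (Fin σ) F // N.rank = u ∧ w ∉ span F (Set.range N.row)} +
        Nat.card {N : Matrix (Fin p) (Fin σ) F // N.rank = u ∧ w ∈ span F (Set.range N.row)} =
      Nat.card {N : Matrix (Fin p) (Fin σ) F // N.rank = u} := by
  rw [Nat.card_eq_fintype_card, Nat.card_eq_fintype_card, Nat.card_eq_fintype_card, Fintype.card_subtype,
    Fintype.card_subtype, Fintype.card_subtype, ← Finset.card_union_of_disjoint]
  · congr 1
    ext N
    simp only [Finset.mem_union, Finset.mem_filter, Finset.mem_univ, true_and]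
    constructor
    · rintro (⟨h1, -⟩ | ⟨h1, -⟩)
      · exact h1
      · exact h1
    · intro h
      by_cases hw : w ∈ span F (Set.range N.row)
      · exact Or.inr ⟨h, hw⟩
      · exact Or.inl ⟨h, hw⟩
  · rw [Finset.disjoint_filter]
    intro N _ h1 h2
    exact h1.2 h2.2

omit [Fintype F] in
/-- No `N` has `rank [N; w] = 0` when `w ≠ 0` (so for `D ≠ 0` the fibre has no rank-one matrix:
`v*_1 = R_1^{(n−1,s−1)}`). [cite: Nazarov2023FiniteFieldLB, Lemma 2 (proof, the case `r = 1`)] -/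
theorem card_rank_snocRow_zero (w : Fin σ → F) (hw : w ≠ 0) :
    Nat.card {N : Matrix (Fin p) (Fin σ) F // (snocRow N w).rank + 1 = 1} = 0 := by
  rw [Nat.card_eq_zero]
  left
  refine ⟨fun N => hw ?_⟩
  have h : (snocRow N.1 w).rank = 0 := by have := N.2; omega
  rw [Matrix.rank_eq_finrank_span_row, Submodule.finrank_eq_zero, range_snocRow_row] at h
  have hw' : w ∈ span F (insert w (Set.range N.1.row)) := Submodule.subset_span (Set.mem_insert _ _)
  rw [h] at hw'
  exact (Submodule.mem_bot F).1 hw'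

/-- Notation: `q = #F` as an integer. [folklore] -/
local notation "𝔮" => (Fintype.card F : ℤ)

/-- **The `N*`-count of Lemma 2** (`w ≠ 0`, `u + 1 ≤ σ`):
`#{N ∈ F^{p×σ} : rank [N; w] = u + 1} = q^p · [σ−1 choose u]_q · ∏_{i<u} (q^p − q^i)`
(the sum `X_lin + X̄_lin` of the source per normalised `D`, divided by `K^{s−1}`).
[cite: Nazarov2023FiniteFieldLB, Lemma 2 (proof, `X_lin + X̄_lin`, p. 45)] -/
theorem card_rank_snocRow_succ (w : Fin σ → F) (hw : w ≠ 0) (u : ℕ) (hu : u + 1 ≤ σ) :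
    (Nat.card {N : Matrix (Fin p) (Fin σ) F // (snocRow N w).rank + 1 = u + 2} : ℤ) =
      𝔮 ^ p * qBinomial 𝔮 (σ - 1) u * ∏ i ∈ range u, (𝔮 ^ p - 𝔮 ^ i) := by
  have e1 : Nat.card {N : Matrix (Fin p) (Fin σ) F // (snocRow N w).rank + 1 = u + 2} =
      Nat.card {N : Matrix (Fin p) (Fin σ) F // (snocRow N w).rank = u + 1} :=
    Nat.card_congr (Equiv.subtypeEquivRight fun N => by omega)
  have e2 := card_rank_snocRow (p := p) w u
  have e3 := card_rank_not_mem_add (p := p) w u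
  have hA1 := card_rank_eq_and_mem (p := p) w hw u hu
  have hB := card_rank_eq' (F := F) p σ u
  have e3' : (Nat.card {N : Matrix (Fin p) (Fin σ) F // N.rank = u ∧ w ∉ span F (Set.range N.row)} : ℤ) =
      Nat.card {N : Matrix (Fin p) (Fin σ) F // N.rank = u} -
        Nat.card {N : Matrix (Fin p) (Fin σ) F // N.rank = u ∧ w ∈ span F (Set.range N.row)} := by
    rw [← e3]
    push_cast
    ring
  rw [e1, e2, Nat.cast_add, hA1, e3', hB]
  -- `A'(u)`: `u = 0` gives `0`, `u = v + 1` gives `[σ−1 choose v] ∏_{i ≤ v}`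
  cases u with
  | zero =>
    rw [card_rank_zero_and_mem w hw]
    simp
  | succ v =>
    rw [card_rank_eq_and_mem (p := p) w hw v (by omega), Finset.prod_range_succ, Finset.prod_range_succ,
      show σ = (σ - 1) + 1 by omega, qBinomial_succ_succ, show σ - 1 + 1 - 1 = σ - 1 by omega]
    ring

/-- **Lemma 2, the count, `r ≥ 2`** (`n = p + 2 ≤ s = σ + 1`, `r = t + 2 ≤ n`):
`v*_r = R_r^{(n−1,s−1)} + (K^{n−1} − 1) K^{s−1} K^{n−2} [s−2 choose r−2]_K ∏_{i<r−2} (K^{n−2} − K^i)`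
— the printed `X₀ + X_lin + X̄_lin`. [cite: Nazarov2023FiniteFieldLB, Lemma 2 (the formula for `v*_r`, p. 45)] -/
theorem card_InL_rank_add_two (h1 : 1 ≤ p + 2) (h2 : p + 2 ≤ σ + 1) (t : ℕ) (ht : t ≤ p) :
    (Nat.card {M : Matrix (Fin (p + 2)) (Fin (σ + 1)) F // InL h1 h2 M ∧ M.rank = t + 2} : ℤ) =
      qBinomial 𝔮 σ (t + 2) * ∏ i ∈ range (t + 2), (𝔮 ^ (p + 1) - 𝔮 ^ i) +
        (𝔮 ^ (p + 1) - 1) * 𝔮 ^ σ * (𝔮 ^ p * qBinomial 𝔮 (σ - 1) t * ∏ i ∈ range t, (𝔮 ^ p - 𝔮 ^ i)) := by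
  have hps : p + 1 ≤ σ := by omega
  have hsum : ∀ D ∈ (Finset.univ : Finset (Fin (p + 1) → F)).erase 0,
      (Nat.card {C : Matrix (Fin (p + 1)) (Fin (σ + 1)) F //
          lastColV C = D ∧ (snocRow C (wD D)).rank = t + 2} : ℤ) =
        𝔮 ^ σ * (𝔮 ^ p * qBinomial 𝔮 (σ - 1) t * ∏ i ∈ range t, (𝔮 ^ p - 𝔮 ^ i)) := by
    intro D hD
    have hD0 : D ≠ 0 := Finset.ne_of_mem_erase hD
    rw [card_fibre_ne_zero hps hD0, Nat.cast_mul, Nat.cast_pow,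
      card_rank_snocRow_succ (wD' D) (wD'_ne_zero hps hD0) t (by omega)]
  rw [Nat.card_congr (lStarEquiv h1 h2 (t + 2)), card_eq_sum_lastColV,
    ← Finset.add_sum_erase _ _ (Finset.mem_univ (0 : Fin (p + 1) → F)), card_fibre_zero, Nat.cast_add,
    card_rank_eq', Nat.cast_sum, Finset.sum_congr rfl hsum, Finset.sum_const,
    Finset.card_erase_of_mem (Finset.mem_univ _), Finset.card_univ, Fintype.card_fun, Fintype.card_fin,
    nsmul_eq_mul]
  have hq : 1 ≤ Fintype.card F ^ (p + 1) := Nat.one_le_pow _ _ Fintype.card_pos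
  rw [Nat.cast_sub hq]
  push_cast
  ring

/-- **Lemma 2, the count, `r = 1`**: `v*_1 = R_1^{(n−1,s−1)}` ("the rank-one matrices of `L*` are spanned
by the `V*_{i,j}`, `j < s`"). [cite: Nazarov2023FiniteFieldLB, Lemma 2 (proof, the case `r = 1`)] -/
theorem card_InL_rank_one (h1 : 1 ≤ p + 2) (h2 : p + 2 ≤ σ + 1) :
    (Nat.card {M : Matrix (Fin (p + 2)) (Fin (σ + 1)) F // InL h1 h2 M ∧ M.rank = 1} : ℤ) =
      qBinomial 𝔮 σ 1 * ∏ i ∈ range 1, (𝔮 ^ (p + 1) - 𝔮 ^ i) := by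
  have hps : p + 1 ≤ σ := by omega
  have hsum : ∀ D ∈ (Finset.univ : Finset (Fin (p + 1) → F)).erase 0,
      Nat.card {C : Matrix (Fin (p + 1)) (Fin (σ + 1)) F // lastColV C = D ∧ (snocRow C (wD D)).rank = 1} = 0 := by
    intro D hD
    have hD0 : D ≠ 0 := Finset.ne_of_mem_erase hD
    rw [card_fibre_ne_zero hps hD0, card_rank_snocRow_zero _ (wD'_ne_zero hps hD0), mul_zero]
  rw [Nat.card_congr (lStarEquiv h1 h2 1), card_eq_sum_lastColV,
    ← Finset.add_sum_erase _ _ (Finset.mem_univ (0 : Fin (p + 1) → F)), card_fibre_zero,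
    Finset.sum_eq_zero hsum, add_zero, card_rank_eq']

/-- Rank `0`: the zero matrix lies in `L*`, so `#{rank 0} ≤ #{L* ∩ rank 0}` (both are `1`).
[cite: Nazarov2023FiniteFieldLB, Lemma 2 (proof)] -/
theorem card_rank_zero_le (h1 : 1 ≤ p + 2) (h2 : p + 2 ≤ σ + 1) :
    (Finset.univ.filter fun C : Matrix (Fin (p + 2)) (Fin (σ + 1)) F => C.rank = 0).card ≤
      (Finset.univ.filter fun C : Matrix (Fin (p + 2)) (Fin (σ + 1)) F => InL h1 h2 C ∧ C.rank = 0).card := by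
  refine Finset.card_le_card fun C hC => ?_
  simp only [Finset.mem_filter, Finset.mem_univ, true_and] at hC ⊢
  refine ⟨?_, hC⟩
  have h0 : C = 0 := by
    have h := hC
    rw [Matrix.rank_eq_finrank_span_row, Submodule.finrank_eq_zero, Submodule.span_eq_bot] at h
    ext i j
    exact congrFun (h _ ⟨i, rfl⟩) j
  rw [h0]
  exact inL_zero h1 h2

end VStar

/-! ## Gaussian-binomial bookkeeping (closed forms of the ratios `R_r / v*_r`) -/

section QBinomialLemmas

variable {R : Type*} [CommRing R]

/-- Absorption: `[L+1 choose k+1]_q (q^{k+1} − 1) = [L choose k]_q (q^{L+1} − 1)` (in the source: the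
quotients `R_r^{(n,s)} / R_{r−1}^{(n−1,s−1)}`, p. 45). [cite: Nazarov2023FiniteFieldLB, Lemma 2 (proof, p. 45)] -/
theorem qBinomial_absorb (q : R) (L k : ℕ) :
    qBinomial q (L + 1) (k + 1) * (q ^ (k + 1) - 1) = qBinomial q L k * (q ^ (L + 1) - 1) := by
  rcases le_or_gt k L with hk | hk
  · obtain ⟨m, rfl⟩ := Nat.exists_eq_add_of_le hk
    cases m with
    | zero =>
      simp
    | succ m =>
      have h1 := qBinomial_succ_succ' q k (m + 1)
      have h2 := qBinomial_key q k m
      rw [show k + (m + 1) + 1 = k + m + 1 + 1 by ring, show k + (m + 1) = k + m + 1 by ring] at h1 ⊢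
      linear_combination (q ^ (k + 1) - 1) * h1 + h2
  · rw [qBinomial_eq_zero_of_lt q (by omega : L + 1 < k + 1), qBinomial_eq_zero_of_lt q hk]
    ring

/-- `[L choose t+1]_q (q^{t+1} − 1) q^{t+1} = [L choose t]_q (q^{L+1} − q^{t+1})` for `t ≤ L`.
[cite: Nazarov2023FiniteFieldLB, Lemma 2 (proof, p. 45)] -/
theorem qBinomial_key' (q : R) {L t : ℕ} (ht : t ≤ L) :
    qBinomial q L (t + 1) * (q ^ (t + 1) - 1) * q ^ (t + 1) = qBinomial q L t * (q ^ (L + 1) - q ^ (t + 1)) := by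
  rcases Nat.eq_or_lt_of_le ht with rfl | hlt
  · rw [qBinomial_eq_zero_of_lt q (Nat.lt_succ_self t), qBinomial_self]
    ring
  · obtain ⟨m, rfl⟩ := Nat.exists_eq_add_of_lt hlt
    have h := qBinomial_key q t m
    linear_combination q ^ (t + 1) * h

/-- `∏_{i ≤ t} (q^{a+1} − q^i) = (q^{a+1} − 1) q^t ∏_{i<t} (q^a − q^i)` (the source's step
`(K^s − 1)(K^s − K)⋯ = (K^s − 1) K^{r−1} (K^{s−1} − 1)⋯`, p. 45). [cite: Nazarov2023FiniteFieldLB, Lemma 2 (proof, p. 45)] -/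
theorem prod_range_succ_shift (q : R) (a t : ℕ) :
    ∏ i ∈ range (t + 1), (q ^ (a + 1) - q ^ i) = (q ^ (a + 1) - 1) * q ^ t * ∏ i ∈ range t, (q ^ a - q ^ i) := by
  induction t with
  | zero => simp
  | succ t ih =>
    rw [Finset.prod_range_succ, ih, Finset.prod_range_succ]
    ring

/-- `[L choose 1]_q (q − 1) = q^L − 1`. [cite: Nazarov2023FiniteFieldLB, Lemma 1 (proof, base case `R_1`)] -/
theorem qBinomial_one_mul (q : R) (L : ℕ) : qBinomial q L 1 * (q - 1) = q ^ L - 1 := by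
  induction L with
  | zero => simp
  | succ L ih =>
    rw [qBinomial_succ_succ, qBinomial_zero_right]
    linear_combination q * ih

/-- `R_{t+2}^{(p+2,τ+2)} · (q^{t+2} − 1)(q^{t+1} − 1)` over the base `[τ choose t]_q ∏_{i<t}(q^p − q^i)`.
[cite: Nazarov2023FiniteFieldLB, Lemma 2 (proof, the quotient `q*_r`, pp. 45–46)] -/
theorem Rc_eq (q : R) (p τ t : ℕ) :
    qBinomial q (τ + 2) (t + 2) * (∏ i ∈ range (t + 2), (q ^ (p + 2) - q ^ i)) *
        ((q ^ (t + 2) - 1) * (q ^ (t + 1) - 1)) =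
      (qBinomial q τ t * ∏ i ∈ range t, (q ^ p - q ^ i)) *
        ((q ^ (τ + 2) - 1) * (q ^ (τ + 1) - 1) * (q ^ (p + 2) - 1) * (q ^ (p + 1) - 1) * q ^ (2 * t + 1)) := by
  have h1 := qBinomial_absorb q (τ + 1) (t + 1)
  have h2 := qBinomial_absorb q τ t
  rw [prod_range_succ_shift q (p + 1) (t + 1), prod_range_succ_shift q p t]
  linear_combination ((∏ i ∈ range t, (q ^ p - q ^ i)) * ((q ^ (p + 2) - 1) * q ^ (t + 1) *
      ((q ^ (p + 1) - 1) * q ^ t)) * (q ^ (t + 1) - 1)) * h1 +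
    ((∏ i ∈ range t, (q ^ p - q ^ i)) * ((q ^ (p + 2) - 1) * q ^ (t + 1) * ((q ^ (p + 1) - 1) * q ^ t)) *
      (q ^ (τ + 2) - 1)) * h2

/-- `v*_{t+2} · (q^{t+2} − 1)(q^{t+1} − 1)` over the same base. [cite: Nazarov2023FiniteFieldLB, Lemma 2 (proof, the quotient `q*_r`, pp. 45–46)] -/
theorem Vc_eq (q : R) (p τ t : ℕ) (ht : t ≤ τ) :
    (qBinomial q (τ + 1) (t + 2) * (∏ i ∈ range (t + 2), (q ^ (p + 1) - q ^ i)) +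
          (q ^ (p + 1) - 1) * q ^ (τ + 1) * (q ^ p * qBinomial q τ t * ∏ i ∈ range t, (q ^ p - q ^ i))) *
        ((q ^ (t + 2) - 1) * (q ^ (t + 1) - 1)) =
      (qBinomial q τ t * ∏ i ∈ range t, (q ^ p - q ^ i)) *
        ((q ^ (p + 1) - 1) * ((q ^ (τ + 1) - 1) * (q ^ (τ + 1) - q ^ (t + 1)) * (q ^ p - q ^ t) +
          q ^ (τ + 1 + p) * ((q ^ (t + 2) - 1) * (q ^ (t + 1) - 1)))) := by
  have h1 := qBinomial_absorb q τ (t + 1)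
  have h2 := qBinomial_key' q ht
  rw [prod_range_succ_shift q p (t + 1), Finset.prod_range_succ]
  linear_combination ((q ^ (p + 1) - 1) * ((∏ i ∈ range t, (q ^ p - q ^ i)) * (q ^ p - q ^ t)) * q ^ (t + 1) *
      (q ^ (t + 1) - 1)) * h1 +
    ((q ^ (p + 1) - 1) * ((∏ i ∈ range t, (q ^ p - q ^ i)) * (q ^ p - q ^ t)) * (q ^ (τ + 1) - 1)) * h2

end QBinomialLemmas

/-! ## The two polynomial inequalities (minimisation of `q*_r` over `r`, pp. 46–47) -/

section Inequalities

/-- Case `s = n`: `(q²P − 2q + 1)(qP − 1) Y² ≤ (qP − 1)(P − Y)² + P²(q²Y − 1)(qY − 1)` for `Y = q^{r−2}`,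
`P = q^{n−2}`, the difference being `(P − qY)(qP² − (3qP − 2)Y)` (minimum at `r = n − 1`, where it
vanishes). [cite: Nazarov2023FiniteFieldLB, Lemma 2 (proof, "first case: `n = s`", p. 46)] -/
theorem core_sn (q P Y : ℤ) (hq : 2 ≤ q) (hY : 1 ≤ Y) (hP : Y = P ∨ q * Y = P ∨ q ^ 2 * Y ≤ P) :
    (q ^ 2 * P - 2 * q + 1) * (q * P - 1) * Y ^ 2 ≤
      (q * P - 1) * (P - Y) ^ 2 + P ^ 2 * (q ^ 2 * Y - 1) * (q * Y - 1) := by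
  have key : (q * P - 1) * (P - Y) ^ 2 + P ^ 2 * (q ^ 2 * Y - 1) * (q * Y - 1) -
      (q ^ 2 * P - 2 * q + 1) * (q * P - 1) * Y ^ 2 = (P - q * Y) * (q * P ^ 2 - (3 * q * P - 2) * Y) := by
    ring
  rw [← sub_nonneg, key]
  rcases hP with rfl | rfl | h
  · have e : (Y - q * Y) * (q * Y ^ 2 - (3 * q * Y - 2) * Y) = 2 * Y ^ 2 * (q - 1) * (q * Y - 1) := by ring
    rw [e]
    have h1 : 0 ≤ q - 1 := by linarith
    have h2 : 0 ≤ q * Y - 1 := by nlinarith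
    positivity
  · rw [sub_self, zero_mul]
  · have hY0 : 0 ≤ Y := by linarith
    have hP0 : 0 ≤ P := by nlinarith
    have h1 : 0 ≤ P - q * Y := by nlinarith
    have h2 : 0 ≤ q * (q * P ^ 2 - (3 * q * P - 2) * Y) := by
      have h3 : q * (q * P ^ 2 - (3 * q * P - 2) * Y) = q ^ 2 * P ^ 2 - 3 * P * (q ^ 2 * Y) + 2 * q * Y := by
        ring
      rw [h3]
      have h4 : P * (q ^ 2 * Y) ≤ P * P := mul_le_mul_of_nonneg_left h hP0
      have h5 : 4 * P ^ 2 ≤ q ^ 2 * P ^ 2 := by nlinarith [sq_nonneg P, mul_nonneg (by linarith : (0 : ℤ) ≤ q - 2) (by linarith : (0 : ℤ) ≤ q + 2)]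
      have h6 : 0 ≤ q * Y := by positivity
      nlinarith [sq_nonneg P]
    have h3 : 0 ≤ q * P ^ 2 - (3 * q * P - 2) * Y :=
      le_of_mul_le_mul_left (by rw [mul_zero]; exact h2) (by linarith : (0 : ℤ) < q)
    exact mul_nonneg h1 h3

/-- Case `s > n`: `W(q²P − 1)(qP − 1) Y² ≤ (qWP − 1)(WP − Y)(P − Y) + WP²(q²Y − 1)(qY − 1)` for
`Y = q^{r−2}`, `P = q^{n−2}`, `W = q^{s−n}`, the difference being `(P − Y)(qWP(WP − 2Y − qY) + Y(1 + W))`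
(minimum at `r = n`, where it vanishes). [cite: Nazarov2023FiniteFieldLB, Lemma 2 (proof, "second case: `n < s`", pp. 46–47)] -/
theorem core_sgn (q W P Y : ℤ) (hq : 2 ≤ q) (hW : q ≤ W) (hY : 1 ≤ Y) (hP : Y = P ∨ q * Y ≤ P) :
    W * (q ^ 2 * P - 1) * (q * P - 1) * Y ^ 2 ≤
      (q * W * P - 1) * (W * P - Y) * (P - Y) + W * P ^ 2 * (q ^ 2 * Y - 1) * (q * Y - 1) := by
  have key : (q * W * P - 1) * (W * P - Y) * (P - Y) + W * P ^ 2 * (q ^ 2 * Y - 1) * (q * Y - 1) -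
      W * (q ^ 2 * P - 1) * (q * P - 1) * Y ^ 2 =
        (P - Y) * (q * W * P * (W * P - 2 * Y - q * Y) + Y * (1 + W)) := by
    ring
  rw [← sub_nonneg, key]
  rcases hP with rfl | h
  · rw [sub_self, zero_mul]
  · have hY0 : 0 ≤ Y := by linarith
    have hP0 : 0 ≤ P := by nlinarith
    have h1 : 0 ≤ P - Y := by nlinarith
    have h2 : 0 ≤ W * P - 2 * Y - q * Y := by
      -- `W P ≥ q P ≥ q (q Y) ≥ (q + 2) Y`
      have h3 : q * P ≤ W * P := mul_le_mul_of_nonneg_right hW hP0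
      have h4 : q * (q * Y) ≤ q * P := mul_le_mul_of_nonneg_left h (by linarith)
      nlinarith
    have hW0 : 0 ≤ W := by linarith
    have h5 : 0 ≤ q * W * P * (W * P - 2 * Y - q * Y) := by positivity
    have h6 : 0 ≤ Y * (1 + W) := by positivity
    exact mul_nonneg h1 (by linarith)

/-- **Lemma 2 for `s = n`, `r = t + 2`** (`n = p + 2`): `(K^n − 2K + 1) R_r ≤ (K^n − 1)² v*_r`, i.e.
`q*_r ≥ 1/f(K,n,n)`. [cite: Nazarov2023FiniteFieldLB, Lemma 2 (case `n = s`)] -/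
theorem ineq_sn (q : ℤ) (hq : 2 ≤ q) (p t : ℕ) (ht : t ≤ p)
    (hG : 0 ≤ qBinomial q p t * ∏ i ∈ range t, (q ^ p - q ^ i)) :
    (q ^ (p + 2) - 2 * q + 1) * (qBinomial q (p + 2) (t + 2) * ∏ i ∈ range (t + 2), (q ^ (p + 2) - q ^ i)) ≤
      (q ^ (p + 2) - 1) ^ 2 * (qBinomial q (p + 1) (t + 2) * ∏ i ∈ range (t + 2), (q ^ (p + 1) - q ^ i) +
        (q ^ (p + 1) - 1) * q ^ (p + 1) * (q ^ p * qBinomial q p t * ∏ i ∈ range t, (q ^ p - q ^ i))) := by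
  have hq1 : 1 ≤ q := by linarith
  have hc : 0 < (q ^ (t + 2) - 1) * (q ^ (t + 1) - 1) := by
    have h1 : 1 < q ^ (t + 2) := one_lt_pow₀ (by linarith) (by omega)
    have h2 : 1 < q ^ (t + 1) := one_lt_pow₀ (by linarith) (by omega)
    exact mul_pos (by linarith) (by linarith)
  refine le_of_mul_le_mul_right ?_ hc
  have hRc := Rc_eq q p p t
  have hVc := Vc_eq q p p t ht
  -- reduce to `core_sn` with `P = q^p`, `Y = q^t`
  have hY : (1 : ℤ) ≤ q ^ t := one_le_pow₀ hq1
  have hPY : q ^ t = q ^ p ∨ q * q ^ t = q ^ p ∨ q ^ 2 * q ^ t ≤ q ^ p := by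
    rcases Nat.lt_or_ge p (t + 2) with h | h
    · rcases Nat.eq_or_lt_of_le ht with h' | h'
      · left
        rw [h']
      · right
        left
        rw [← pow_succ', show t + 1 = p by omega]
    · right
      right
      rw [← pow_add]
      exact pow_le_pow_right₀ hq1 (by omega)
  have core := core_sn q (q ^ p) (q ^ t) hq hY hPY
  have hM : 0 ≤ (qBinomial q p t * ∏ i ∈ range t, (q ^ p - q ^ i)) *
      ((q ^ (p + 2) - 1) ^ 2 * (q ^ (p + 1) - 1) * q) := by
    have h1 : 0 ≤ q ^ (p + 1) - 1 := by linarith [one_le_pow₀ (M₀ := ℤ) (a := q) (n := p + 1) hq1]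
    positivity
  have e1 : (q ^ (p + 2) - 2 * q + 1) *
      (qBinomial q (p + 2) (t + 2) * ∏ i ∈ range (t + 2), (q ^ (p + 2) - q ^ i)) *
        ((q ^ (t + 2) - 1) * (q ^ (t + 1) - 1)) =
      (qBinomial q p t * ∏ i ∈ range t, (q ^ p - q ^ i)) * ((q ^ (p + 2) - 1) ^ 2 * (q ^ (p + 1) - 1) * q) *
        ((q ^ 2 * q ^ p - 2 * q + 1) * (q * q ^ p - 1) * (q ^ t) ^ 2) := by
    linear_combination (q ^ (p + 2) - 2 * q + 1) * hRc
  have e2 : (q ^ (p + 2) - 1) ^ 2 *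
      (qBinomial q (p + 1) (t + 2) * ∏ i ∈ range (t + 2), (q ^ (p + 1) - q ^ i) +
        (q ^ (p + 1) - 1) * q ^ (p + 1) * (q ^ p * qBinomial q p t * ∏ i ∈ range t, (q ^ p - q ^ i))) *
        ((q ^ (t + 2) - 1) * (q ^ (t + 1) - 1)) =
      (qBinomial q p t * ∏ i ∈ range t, (q ^ p - q ^ i)) * ((q ^ (p + 2) - 1) ^ 2 * (q ^ (p + 1) - 1) * q) *
        ((q * q ^ p - 1) * (q ^ p - q ^ t) ^ 2 + (q ^ p) ^ 2 * (q ^ 2 * q ^ t - 1) * (q * q ^ t - 1)) := by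
    linear_combination (q ^ (p + 2) - 1) ^ 2 * hVc
  rw [e1, e2]
  exact mul_le_mul_of_nonneg_left core hM

/-- **Lemma 2 for `s > n`, `r = t + 2`** (`n = p + 2`, `s = p + e + 2`, `e ≥ 1`):
`(K^{s−1} − K^{s−n}) R_r ≤ (K^{s−1} − 1)(K^s − 1) v*_r`, i.e. `q*_r ≥ 1/f(K,n,s)`.
[cite: Nazarov2023FiniteFieldLB, Lemma 2 (case `n < s`)] -/
theorem ineq_sgn (q : ℤ) (hq : 2 ≤ q) (p e t : ℕ) (he : 1 ≤ e) (ht : t ≤ p)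
    (hG : 0 ≤ qBinomial q (p + e) t * ∏ i ∈ range t, (q ^ p - q ^ i)) :
    (q ^ (p + e + 1) - q ^ e) *
        (qBinomial q (p + e + 2) (t + 2) * ∏ i ∈ range (t + 2), (q ^ (p + 2) - q ^ i)) ≤
      (q ^ (p + e + 1) - 1) * (q ^ (p + e + 2) - 1) *
        (qBinomial q (p + e + 1) (t + 2) * ∏ i ∈ range (t + 2), (q ^ (p + 1) - q ^ i) +
          (q ^ (p + 1) - 1) * q ^ (p + e + 1) *
            (q ^ p * qBinomial q (p + e) t * ∏ i ∈ range t, (q ^ p - q ^ i))) := by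
  have hq1 : 1 ≤ q := by linarith
  have hc : 0 < (q ^ (t + 2) - 1) * (q ^ (t + 1) - 1) := by
    have h1 : 1 < q ^ (t + 2) := one_lt_pow₀ (by linarith) (by omega)
    have h2 : 1 < q ^ (t + 1) := one_lt_pow₀ (by linarith) (by omega)
    exact mul_pos (by linarith) (by linarith)
  refine le_of_mul_le_mul_right ?_ hc
  have hRc := Rc_eq q p (p + e) t
  have hVc := Vc_eq q p (p + e) t (by omega)
  have hY : (1 : ℤ) ≤ q ^ t := one_le_pow₀ hq1
  have hW : q ≤ q ^ e := by
    calc q = q ^ 1 := (pow_one q).symm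
      _ ≤ q ^ e := pow_le_pow_right₀ hq1 he
  have hPY : q ^ t = q ^ p ∨ q * q ^ t ≤ q ^ p := by
    rcases Nat.eq_or_lt_of_le ht with h' | h'
    · left
      rw [h']
    · right
      rw [← pow_succ']
      exact pow_le_pow_right₀ hq1 (by omega)
  have core := core_sgn q (q ^ e) (q ^ p) (q ^ t) hq hW hY hPY
  have hM : 0 ≤ (qBinomial q (p + e) t * ∏ i ∈ range t, (q ^ p - q ^ i)) *
      ((q ^ (p + e + 1) - 1) * (q ^ (p + e + 2) - 1) * (q ^ (p + 1) - 1) * q) := by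
    have h1 : 0 ≤ q ^ (p + 1) - 1 := by linarith [one_le_pow₀ (M₀ := ℤ) (a := q) (n := p + 1) hq1]
    have h2 : 0 ≤ q ^ (p + e + 1) - 1 := by
      linarith [one_le_pow₀ (M₀ := ℤ) (a := q) (n := p + e + 1) hq1]
    have h3 : 0 ≤ q ^ (p + e + 2) - 1 := by
      linarith [one_le_pow₀ (M₀ := ℤ) (a := q) (n := p + e + 2) hq1]
    positivity
  have e1 : (q ^ (p + e + 1) - q ^ e) *
      (qBinomial q (p + e + 2) (t + 2) * ∏ i ∈ range (t + 2), (q ^ (p + 2) - q ^ i)) *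
        ((q ^ (t + 2) - 1) * (q ^ (t + 1) - 1)) =
      (qBinomial q (p + e) t * ∏ i ∈ range t, (q ^ p - q ^ i)) *
        ((q ^ (p + e + 1) - 1) * (q ^ (p + e + 2) - 1) * (q ^ (p + 1) - 1) * q) *
        (q ^ e * (q ^ 2 * q ^ p - 1) * (q * q ^ p - 1) * (q ^ t) ^ 2) := by
    linear_combination (q ^ (p + e + 1) - q ^ e) * hRc
  have e2 : (q ^ (p + e + 1) - 1) * (q ^ (p + e + 2) - 1) *
      (qBinomial q (p + e + 1) (t + 2) * ∏ i ∈ range (t + 2), (q ^ (p + 1) - q ^ i) +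
        (q ^ (p + 1) - 1) * q ^ (p + e + 1) *
          (q ^ p * qBinomial q (p + e) t * ∏ i ∈ range t, (q ^ p - q ^ i))) *
        ((q ^ (t + 2) - 1) * (q ^ (t + 1) - 1)) =
      (qBinomial q (p + e) t * ∏ i ∈ range t, (q ^ p - q ^ i)) *
        ((q ^ (p + e + 1) - 1) * (q ^ (p + e + 2) - 1) * (q ^ (p + 1) - 1) * q) *
        ((q * q ^ e * q ^ p - 1) * (q ^ e * q ^ p - q ^ t) * (q ^ p - q ^ t) +
          q ^ e * (q ^ p) ^ 2 * (q ^ 2 * q ^ t - 1) * (q * q ^ t - 1)) := by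
    linear_combination (q ^ (p + e + 1) - 1) * (q ^ (p + e + 2) - 1) * hVc
  rw [e1, e2]
  exact mul_le_mul_of_nonneg_left core hM

end Inequalities

/-! ## Lemma 2 in the form required by `nazarov2023_rank_matMulTensor_ge_of_count` -/

section Hyp

variable [Fintype F] {p τ : ℕ}

local notation "𝔮" => (Fintype.card F : ℤ)

omit [Fintype F] in
/-- `2 ≤ q`. [folklore] -/
private theorem two_le_q [Fintype F] : (2 : ℤ) ≤ 𝔮 := by
  exact_mod_cast (Fintype.one_lt_card : 1 < Fintype.card F)

/-- The base `[τ choose t]_q ∏_{i<t} (q^p − q^i)` is nonnegative (`t ≤ p`). [cite: Cohn2004, Thm. 1] -/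
theorem base_nonneg (τ : ℕ) {p t : ℕ} (ht : t ≤ p) :
    0 ≤ qBinomial 𝔮 τ t * ∏ i ∈ range t, (𝔮 ^ p - 𝔮 ^ i) := by
  refine mul_nonneg ?_ (Finset.prod_nonneg fun i hi => ?_)
  · rw [← Nat.card_eq_fintype_card, ← card_subspaces_fin_eq_qBinomial (k := F) τ t]
    positivity
  · have hi' : i < t := Finset.mem_range.1 hi
    have h : 𝔮 ^ i ≤ 𝔮 ^ p := pow_le_pow_right₀ (by linarith [two_le_q (F := F)]) (by omega)
    linarith

/-- **Lemma 2 (Nazarov 2023), as the hypothesis of the counting assembly**: for `s ≥ n ≥ 3`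
(`n = p + 2`, `s = τ + 2`) and the integers `a, b` with `a/b = f(K,n,s)`, every rank class satisfies
`b · R_r^{(n,s)} ≤ a · v*_r`, i.e. `q*_r ≥ 1/f(K,n,s)`. [cite: Nazarov2023FiniteFieldLB, Lemma 2] -/
theorem lemma2_hyp (hp : 1 ≤ p) (a b : ℕ)
    (hab : (τ = p ∧ (a : ℤ) = (𝔮 ^ (p + 2) - 1) ^ 2 ∧ (b : ℤ) = 𝔮 ^ (p + 2) - 2 * 𝔮 + 1) ∨
      (p < τ ∧ (a : ℤ) = (𝔮 ^ (τ + 1) - 1) * (𝔮 ^ (τ + 2) - 1) ∧ (b : ℤ) = 𝔮 ^ (τ + 1) - 𝔮 ^ (τ - p)))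
    (h1 : 1 ≤ p + 2) (h2 : p + 2 ≤ τ + 2) (r : ℕ) (hr : r ≤ p + 2) :
    b * (Finset.univ.filter fun C : Matrix (Fin (p + 2)) (Fin (τ + 2)) F => C.rank = r).card ≤
      a * (Finset.univ.filter fun C : Matrix (Fin (p + 2)) (Fin (τ + 2)) F => InL h1 h2 C ∧ C.rank = r).card := by
  have hq := two_le_q (F := F)
  have hq1 : (1 : ℤ) ≤ 𝔮 := by linarith
  -- `b ≤ a` (used for `r = 0`)
  have hba : (b : ℤ) ≤ a := by
    rcases hab with ⟨-, ha, hb⟩ | ⟨-, ha, hb⟩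
    · rw [ha, hb]
      have h3 : (4 : ℤ) ≤ 𝔮 ^ (p + 2) := by
        calc (4 : ℤ) = 2 ^ 2 := by norm_num
          _ ≤ 𝔮 ^ 2 := pow_le_pow_left₀ (by norm_num) hq 2
          _ ≤ 𝔮 ^ (p + 2) := pow_le_pow_right₀ hq1 (by omega)
      nlinarith
    · rw [ha, hb]
      have h3 : (1 : ℤ) ≤ 𝔮 ^ (τ - p) := one_le_pow₀ hq1
      have h4 : (2 : ℤ) ≤ 𝔮 ^ (τ + 1) := by
        calc (2 : ℤ) ≤ 𝔮 := hq
          _ = 𝔮 ^ 1 := (pow_one _).symm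
          _ ≤ 𝔮 ^ (τ + 1) := pow_le_pow_right₀ hq1 (by omega)
      have h5 : (2 : ℤ) ≤ 𝔮 ^ (τ + 2) := by
        calc (2 : ℤ) ≤ 𝔮 := hq
          _ = 𝔮 ^ 1 := (pow_one _).symm
          _ ≤ 𝔮 ^ (τ + 2) := pow_le_pow_right₀ hq1 (by omega)
      nlinarith
  rcases Nat.lt_or_ge r 2 with hr2 | hr2
  · interval_cases r
    · -- `r = 0`
      calc b * (Finset.univ.filter fun C : Matrix (Fin (p + 2)) (Fin (τ + 2)) F => C.rank = 0).card
          ≤ a * (Finset.univ.filter fun C : Matrix (Fin (p + 2)) (Fin (τ + 2)) F => C.rank = 0).card :=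
            Nat.mul_le_mul_right _ (by exact_mod_cast hba)
        _ ≤ a * (Finset.univ.filter fun C : Matrix (Fin (p + 2)) (Fin (τ + 2)) F =>
              InL h1 h2 C ∧ C.rank = 0).card := Nat.mul_le_mul_left _ (card_rank_zero_le h1 h2)
    · -- `r = 1`
      have hR : ((Finset.univ.filter fun C : Matrix (Fin (p + 2)) (Fin (τ + 2)) F => C.rank = 1).card : ℤ) =
          qBinomial 𝔮 (τ + 2) 1 * (𝔮 ^ (p + 2) - 1) := by
        rw [← Fintype.card_subtype, ← Nat.card_eq_fintype_card, card_rank_eq', Finset.prod_range_one,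
          pow_zero]
      have hV : ((Finset.univ.filter fun C : Matrix (Fin (p + 2)) (Fin (τ + 2)) F =>
          InL h1 h2 C ∧ C.rank = 1).card : ℤ) = qBinomial 𝔮 (τ + 1) 1 * (𝔮 ^ (p + 1) - 1) := by
        rw [← Fintype.card_subtype, ← Nat.card_eq_fintype_card, card_InL_rank_one, Finset.prod_range_one,
          pow_zero]
      have hc : (0 : ℤ) < 𝔮 - 1 := by linarith
      have hP : (2 : ℤ) ≤ 𝔮 ^ p := by
        calc (2 : ℤ) ≤ 𝔮 := hq
          _ = 𝔮 ^ 1 := (pow_one _).symm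
          _ ≤ 𝔮 ^ p := pow_le_pow_right₀ hq1 hp
      have key : (b : ℤ) * (qBinomial 𝔮 (τ + 2) 1 * (𝔮 ^ (p + 2) - 1)) * (𝔮 - 1) ≤
          (a : ℤ) * (qBinomial 𝔮 (τ + 1) 1 * (𝔮 ^ (p + 1) - 1)) * (𝔮 - 1) := by
        rw [show (b : ℤ) * (qBinomial 𝔮 (τ + 2) 1 * (𝔮 ^ (p + 2) - 1)) * (𝔮 - 1) =
            (b : ℤ) * (𝔮 ^ (p + 2) - 1) * (qBinomial 𝔮 (τ + 2) 1 * (𝔮 - 1)) by ring, qBinomial_one_mul,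
          show (a : ℤ) * (qBinomial 𝔮 (τ + 1) 1 * (𝔮 ^ (p + 1) - 1)) * (𝔮 - 1) =
            (a : ℤ) * (𝔮 ^ (p + 1) - 1) * (qBinomial 𝔮 (τ + 1) 1 * (𝔮 - 1)) by ring, qBinomial_one_mul]
        rcases hab with ⟨hτ, ha, hb⟩ | ⟨hlt, ha, hb⟩
        · subst hτ
          rw [ha, hb]
          -- `b (q²P−1)² ≤ (q²P−1)² (qP−1)²` from `b ≤ (qP−1)²`: `(qP−1)² − b = q (P−1)(qP−2)`
          have h3 : 𝔮 ^ (τ + 2) - 2 * 𝔮 + 1 ≤ (𝔮 ^ (τ + 1) - 1) ^ 2 := by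
            have e : (𝔮 ^ (τ + 1) - 1) ^ 2 - (𝔮 ^ (τ + 2) - 2 * 𝔮 + 1) =
                𝔮 * (𝔮 ^ τ - 1) * (𝔮 * 𝔮 ^ τ - 2) := by ring
            have h4 : 0 ≤ 𝔮 * (𝔮 ^ τ - 1) * (𝔮 * 𝔮 ^ τ - 2) := by
              have : 0 ≤ 𝔮 ^ τ - 1 := by linarith
              have : 0 ≤ 𝔮 * 𝔮 ^ τ - 2 := by nlinarith
              positivity
            linarith
          have h5 : 0 ≤ (𝔮 ^ (τ + 2) - 1) * (𝔮 ^ (τ + 2) - 1) := mul_self_nonneg _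
          calc (𝔮 ^ (τ + 2) - 2 * 𝔮 + 1) * (𝔮 ^ (τ + 2) - 1) * (𝔮 ^ (τ + 2) - 1)
              = (𝔮 ^ (τ + 2) - 2 * 𝔮 + 1) * ((𝔮 ^ (τ + 2) - 1) * (𝔮 ^ (τ + 2) - 1)) := by ring
            _ ≤ (𝔮 ^ (τ + 1) - 1) ^ 2 * ((𝔮 ^ (τ + 2) - 1) * (𝔮 ^ (τ + 2) - 1)) :=
                mul_le_mul_of_nonneg_right h3 h5
            _ = (𝔮 ^ (τ + 2) - 1) ^ 2 * (𝔮 ^ (τ + 1) - 1) * (𝔮 ^ (τ + 1) - 1) := by ring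
        · rw [ha, hb]
          obtain ⟨e, rfl⟩ := Nat.exists_eq_add_of_lt hlt
          rw [show p + e + 1 - p = e + 1 by omega]
          -- `W (q²P − 1) ≤ (S − 1)²` with `S = q^{τ+1} = q W P`, after cancelling `(qP − 1)(qS − 1)`
          have hW1 : (1 : ℤ) ≤ 𝔮 ^ (e + 1) := one_le_pow₀ hq1
          have hW0 : (0 : ℤ) ≤ 𝔮 ^ (e + 1) := by linarith
          have hP1 : (2 : ℤ) ≤ 𝔮 ^ (p + 1) := by
            calc (2 : ℤ) ≤ 𝔮 := hq
              _ = 𝔮 ^ 1 := (pow_one _).symm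
              _ ≤ 𝔮 ^ (p + 1) := pow_le_pow_right₀ hq1 (by omega)
          have hS1 : 𝔮 ^ (e + 1) ≤ 𝔮 ^ (p + e + 1 + 1) - 1 := by
            have e1 : 𝔮 ^ (p + e + 1 + 1) = 𝔮 ^ (e + 1) * 𝔮 ^ (p + 1) := by ring
            have e2 : 𝔮 ^ (e + 1) * 2 ≤ 𝔮 ^ (e + 1) * 𝔮 ^ (p + 1) := mul_le_mul_of_nonneg_left hP1 hW0
            rw [e1]
            linarith
          have hS2 : 𝔮 ^ 2 * 𝔮 ^ p - 1 ≤ 𝔮 ^ (p + e + 1 + 1) - 1 := by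
            have e1 : 𝔮 ^ 2 * 𝔮 ^ p = 𝔮 ^ (p + 2) := by ring
            have e2 : 𝔮 ^ (p + 2) ≤ 𝔮 ^ (p + e + 1 + 1) := pow_le_pow_right₀ hq1 (by omega)
            linarith
          have hc0 : (0 : ℤ) ≤ 𝔮 ^ 2 * 𝔮 ^ p - 1 := by nlinarith
          have hd0 : (0 : ℤ) ≤ 𝔮 ^ (p + e + 1 + 1) - 1 := by
            linarith [one_le_pow₀ (M₀ := ℤ) (a := 𝔮) (n := p + e + 1 + 1) hq1]
          have h3 : 𝔮 ^ (e + 1) * (𝔮 ^ 2 * 𝔮 ^ p - 1) ≤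
              (𝔮 ^ (p + e + 1 + 1) - 1) * (𝔮 ^ (p + e + 1 + 1) - 1) :=
            mul_le_mul hS1 hS2 hc0 hd0
          have h4 : 0 ≤ (𝔮 * 𝔮 ^ p - 1) * (𝔮 * 𝔮 ^ (p + e + 1 + 1) - 1) := by
            have : 0 ≤ 𝔮 * 𝔮 ^ p - 1 := by nlinarith
            have : 0 ≤ 𝔮 * 𝔮 ^ (p + e + 1 + 1) - 1 := by
              nlinarith [one_le_pow₀ (M₀ := ℤ) (a := 𝔮) (n := p + e + 1 + 1) hq1]
            positivity
          calc (𝔮 ^ (p + e + 1 + 1) - 𝔮 ^ (e + 1)) * (𝔮 ^ (p + 2) - 1) * (𝔮 ^ (p + e + 1 + 2) - 1)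
              = 𝔮 ^ (e + 1) * (𝔮 ^ 2 * 𝔮 ^ p - 1) *
                  ((𝔮 * 𝔮 ^ p - 1) * (𝔮 * 𝔮 ^ (p + e + 1 + 1) - 1)) := by ring
            _ ≤ (𝔮 ^ (p + e + 1 + 1) - 1) * (𝔮 ^ (p + e + 1 + 1) - 1) *
                  ((𝔮 * 𝔮 ^ p - 1) * (𝔮 * 𝔮 ^ (p + e + 1 + 1) - 1)) := mul_le_mul_of_nonneg_right h3 h4
            _ = (𝔮 ^ (p + e + 1 + 1) - 1) * (𝔮 ^ (p + e + 1 + 2) - 1) * (𝔮 ^ (p + 1) - 1) *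
                  (𝔮 ^ (p + e + 1 + 1) - 1) := by ring
      have key' : (b : ℤ) * (qBinomial 𝔮 (τ + 2) 1 * (𝔮 ^ (p + 2) - 1)) ≤
          (a : ℤ) * (qBinomial 𝔮 (τ + 1) 1 * (𝔮 ^ (p + 1) - 1)) := le_of_mul_le_mul_right key hc
      rw [← hR, ← hV] at key'
      exact_mod_cast key'
  · -- `r = t + 2`
    obtain ⟨t, rfl⟩ : ∃ t, r = t + 2 := ⟨r - 2, by omega⟩
    have ht : t ≤ p := by omega
    have hR : ((Finset.univ.filter fun C : Matrix (Fin (p + 2)) (Fin (τ + 2)) F => C.rank = t + 2).card : ℤ) =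
        qBinomial 𝔮 (τ + 2) (t + 2) * ∏ i ∈ range (t + 2), (𝔮 ^ (p + 2) - 𝔮 ^ i) := by
      rw [← Fintype.card_subtype, ← Nat.card_eq_fintype_card, card_rank_eq']
    have hV : ((Finset.univ.filter fun C : Matrix (Fin (p + 2)) (Fin (τ + 2)) F =>
        InL h1 h2 C ∧ C.rank = t + 2).card : ℤ) =
          qBinomial 𝔮 (τ + 1) (t + 2) * ∏ i ∈ range (t + 2), (𝔮 ^ (p + 1) - 𝔮 ^ i) +
            (𝔮 ^ (p + 1) - 1) * 𝔮 ^ (τ + 1) * (𝔮 ^ p * qBinomial 𝔮 τ t * ∏ i ∈ range t, (𝔮 ^ p - 𝔮 ^ i)) := by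
      rw [← Fintype.card_subtype, ← Nat.card_eq_fintype_card, card_InL_rank_add_two h1 h2 t ht,
        show τ + 1 - 1 = τ by omega]
    have key : (b : ℤ) * (qBinomial 𝔮 (τ + 2) (t + 2) * ∏ i ∈ range (t + 2), (𝔮 ^ (p + 2) - 𝔮 ^ i)) ≤
        (a : ℤ) * (qBinomial 𝔮 (τ + 1) (t + 2) * ∏ i ∈ range (t + 2), (𝔮 ^ (p + 1) - 𝔮 ^ i) +
          (𝔮 ^ (p + 1) - 1) * 𝔮 ^ (τ + 1) * (𝔮 ^ p * qBinomial 𝔮 τ t * ∏ i ∈ range t, (𝔮 ^ p - 𝔮 ^ i))) := by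
      rcases hab with ⟨hτ, ha, hb⟩ | ⟨hlt, ha, hb⟩
      · subst hτ
        rw [ha, hb]
        exact ineq_sn 𝔮 hq τ t ht (base_nonneg τ ht)
      · obtain ⟨e, rfl⟩ := Nat.exists_eq_add_of_lt hlt
        rw [ha, hb, show p + e + 1 - p = e + 1 by omega]
        have h := ineq_sgn 𝔮 hq p (e + 1) t (by omega) ht
          (by rw [show p + (e + 1) = p + e + 1 by ring]; exact base_nonneg (p + e + 1) ht)
        rw [show p + (e + 1) = p + e + 1 by ring] at h
        exact h
    rw [← hR, ← hV] at key
    exact_mod_cast key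

end Hyp

end Nazarov2023

/-! ## The Theorem -/

open Nazarov2023 in
/-- **Nazarov 2023, Theorem — PROVED** (discharge of the named fact `nazarov2023_rank_matMulTensor_ge`):
over a finite field with `K` elements, for `s ≥ n ≥ 2` and every `m`,
`R(⟨n,s,m⟩) ≥ (n + s − 1)(1 + 1/(f(K,n,s) − 1)) m`. Cases `n = 2`: `nazarov2023_rank_matMulTensor_ge_n2`
(Alekseev–Nazarov 2019 for `s = n = 2`); cases `n ≥ 3`: Lemma 2 above fed into
`nazarov2023_rank_matMulTensor_ge_of_count` (Lemmas 3–7).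
[cite: Nazarov2023FiniteFieldLB, Theorem (p. 42) / eq. (7) §4, proof pp. 43–49] -/
theorem nazarov2023_rank_matMulTensor_ge_holds : nazarov2023_rank_matMulTensor_ge := by
  intro F _ _ n s m hn hns
  rcases Nat.eq_or_lt_of_le hn with h2 | h3
  · subst h2
    exact nazarov2023_rank_matMulTensor_ge_n2 F s m hns
  · obtain ⟨p, rfl⟩ : ∃ p, n = p + 2 := ⟨n - 2, by omega⟩
    obtain ⟨τ, rfl⟩ : ∃ τ, s = τ + 2 := ⟨s - 2, by omega⟩
    have hp : 1 ≤ p := by omega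
    have hpτ : p ≤ τ := by omega
    have hK : 2 ≤ Fintype.card F := Fintype.one_lt_card
    have hK1 : 1 ≤ Fintype.card F := by omega
    rcases Nat.eq_or_lt_of_le hpτ with hτ | hτ
    · -- `s = n`
      subst hτ
      have hle : 2 * Fintype.card F ≤ Fintype.card F ^ (p + 2) := by
        calc 2 * Fintype.card F ≤ Fintype.card F * Fintype.card F := Nat.mul_le_mul_right _ hK
          _ = Fintype.card F ^ 2 := (sq _).symm
          _ ≤ Fintype.card F ^ (p + 2) := Nat.pow_le_pow_right hK1 (by omega)
      have h1le : 1 ≤ Fintype.card F ^ (p + 2) := Nat.one_le_pow _ _ hK1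
      have ha : (((Fintype.card F ^ (p + 2) - 1) ^ 2 : ℕ) : ℤ) = ((Fintype.card F : ℤ) ^ (p + 2) - 1) ^ 2 := by
        push_cast [Nat.cast_sub h1le]
        ring
      have hb : ((Fintype.card F ^ (p + 2) - 2 * Fintype.card F + 1 : ℕ) : ℤ) =
          (Fintype.card F : ℤ) ^ (p + 2) - 2 * (Fintype.card F : ℤ) + 1 := by
        push_cast [Nat.cast_sub hle]
        ring
      have hb0 : 0 < Fintype.card F ^ (p + 2) - 2 * Fintype.card F + 1 := by omega
      have hab : Fintype.card F ^ (p + 2) - 2 * Fintype.card F + 1 < (Fintype.card F ^ (p + 2) - 1) ^ 2 := by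
        have h : ((Fintype.card F ^ (p + 2) - 2 * Fintype.card F + 1 : ℕ) : ℤ) <
            (((Fintype.card F ^ (p + 2) - 1) ^ 2 : ℕ) : ℤ) := by
          rw [ha, hb]
          have h4 : (4 : ℤ) ≤ (Fintype.card F : ℤ) ^ (p + 2) := by
            have : 4 ≤ Fintype.card F ^ (p + 2) := le_trans (by nlinarith) hle
            exact_mod_cast this
          nlinarith
        exact_mod_cast h
      have key := nazarov2023_rank_matMulTensor_ge_of_count F (n := p + 2) (s := p + 2) (by omega) le_rfl
        _ _ hb0 hab (fun r hr => lemma2_hyp hp _ _ (Or.inl ⟨rfl, ha, hb⟩) _ _ r hr) m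
      have hf : (((Fintype.card F ^ (p + 2) - 1) ^ 2 : ℕ) : ℚ) /
          ((Fintype.card F ^ (p + 2) - 2 * Fintype.card F + 1 : ℕ) : ℚ) =
            nazarov2023F (Fintype.card F) (p + 2) (p + 2) := by
        unfold nazarov2023F
        rw [if_pos ⟨rfl, by omega⟩]
        push_cast [Nat.cast_sub h1le, Nat.cast_sub hle]
        ring
      rw [hf] at key
      exact key
    · -- `s > n`
      obtain ⟨e, rfl⟩ := Nat.exists_eq_add_of_lt hτ
      have hle : Fintype.card F ^ (e + 1) ≤ Fintype.card F ^ (p + e + 1 + 1) :=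
        Nat.pow_le_pow_right hK1 (by omega)
      have h1le : 1 ≤ Fintype.card F ^ (p + e + 1 + 1) := Nat.one_le_pow _ _ hK1
      have h1le' : 1 ≤ Fintype.card F ^ (p + e + 1 + 2) := Nat.one_le_pow _ _ hK1
      have ha : (((Fintype.card F ^ (p + e + 1 + 1) - 1) * (Fintype.card F ^ (p + e + 1 + 2) - 1) : ℕ) : ℤ) =
          ((Fintype.card F : ℤ) ^ (p + e + 1 + 1) - 1) * ((Fintype.card F : ℤ) ^ (p + e + 1 + 2) - 1) := by
        push_cast [Nat.cast_sub h1le, Nat.cast_sub h1le']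
        ring
      have hb : ((Fintype.card F ^ (p + e + 1 + 1) - Fintype.card F ^ (e + 1) : ℕ) : ℤ) =
          (Fintype.card F : ℤ) ^ (p + e + 1 + 1) - (Fintype.card F : ℤ) ^ (p + e + 1 - p) := by
        rw [show p + e + 1 - p = e + 1 by omega]
        push_cast [Nat.cast_sub hle]
        ring
      have hlt' : Fintype.card F ^ (e + 1) < Fintype.card F ^ (p + e + 1 + 1) :=
        Nat.pow_lt_pow_right hK (by omega)
      have hb0 : 0 < Fintype.card F ^ (p + e + 1 + 1) - Fintype.card F ^ (e + 1) := by omega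
      have hab : Fintype.card F ^ (p + e + 1 + 1) - Fintype.card F ^ (e + 1) <
          (Fintype.card F ^ (p + e + 1 + 1) - 1) * (Fintype.card F ^ (p + e + 1 + 2) - 1) := by
        have h : ((Fintype.card F ^ (p + e + 1 + 1) - Fintype.card F ^ (e + 1) : ℕ) : ℤ) <
            (((Fintype.card F ^ (p + e + 1 + 1) - 1) * (Fintype.card F ^ (p + e + 1 + 2) - 1) : ℕ) : ℤ) := by
          rw [ha, hb, show p + e + 1 - p = e + 1 by omega]
          have h3 : (1 : ℤ) ≤ (Fintype.card F : ℤ) ^ (e + 1) := by exact_mod_cast Nat.one_le_pow _ _ hK1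
          have h4 : (2 : ℤ) ≤ (Fintype.card F : ℤ) ^ (p + e + 1 + 1) := by
            have : 2 ≤ Fintype.card F ^ (p + e + 1 + 1) :=
              le_trans hK (le_trans (le_of_eq (pow_one _).symm) (Nat.pow_le_pow_right hK1 (by omega)))
            exact_mod_cast this
          have h5 : (4 : ℤ) ≤ (Fintype.card F : ℤ) ^ (p + e + 1 + 2) := by
            have h6 : 4 ≤ Fintype.card F ^ 2 := by nlinarith
            have : Fintype.card F ^ 2 ≤ Fintype.card F ^ (p + e + 1 + 2) := Nat.pow_le_pow_right hK1 (by omega)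
            exact_mod_cast le_trans h6 this
          nlinarith [mul_nonneg (show (0 : ℤ) ≤ (Fintype.card F : ℤ) ^ (p + e + 1 + 1) - 2 by linarith)
            (show (0 : ℤ) ≤ (Fintype.card F : ℤ) ^ (p + e + 1 + 2) - 4 by linarith)]
        exact_mod_cast h
      have key := nazarov2023_rank_matMulTensor_ge_of_count F (n := p + 2) (s := p + e + 1 + 2) (by omega)
        (by omega) _ _ hb0 hab (fun r hr => lemma2_hyp hp _ _ (Or.inr ⟨by omega, ha, hb⟩) _ _ r hr) m
      have hf : ((((Fintype.card F ^ (p + e + 1 + 1) - 1) * (Fintype.card F ^ (p + e + 1 + 2) - 1) : ℕ) : ℚ)) /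
          ((Fintype.card F ^ (p + e + 1 + 1) - Fintype.card F ^ (e + 1) : ℕ) : ℚ) =
            nazarov2023F (Fintype.card F) (p + 2) (p + e + 1 + 2) := by
        unfold nazarov2023F
        rw [if_neg (by omega), if_pos ⟨by omega, by omega⟩, show p + e + 1 + 2 - 1 = p + e + 1 + 1 by omega,
          show p + e + 1 + 2 - (p + 2) = e + 1 by omega]
        push_cast [Nat.cast_sub h1le, Nat.cast_sub h1le', Nat.cast_sub hle]
        ring
      rw [hf] at key
      exact key

/-! ## Corollaries over the field with two elements (`n ≥ 3` families) -/

/-- `⟨3,3,m⟩` over a field with `2` elements: `f(2,3,3) = 49/5`, so `R ≥ 5 · (49/44) · m`, i.e.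
`44 · R(⟨3,3,m⟩) ≥ 245 · m` (beats the any-field `5m + 4` of Bläser 2003 Thm 14 from `m = 8` on).
[cite: Nazarov2023FiniteFieldLB, Theorem (K = 2, s = n = 3)] -/
theorem nazarov2023_rank_matMulTensor_33m_gf2 (F : Type) [Field F] [Fintype F] (hF : Fintype.card F = 2)
    (m : ℕ) : 245 * m ≤ 44 * tensorRank (matMulTensor F 3 3 m) := by
  have h := nazarov2023_rank_matMulTensor_ge_holds F 3 3 m (by norm_num) le_rfl
  rw [hF] at h
  have hf : nazarov2023F 2 3 3 = 49 / 5 := by norm_num [nazarov2023F]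
  rw [hf] at h
  norm_num at h
  have h2 : (245 : ℚ) * m ≤ 44 * (tensorRank (matMulTensor F 3 3 m) : ℚ) := by linarith
  exact_mod_cast h2

/-- `⟨3,4,m⟩` over a field with `2` elements: `f(2,3,4) = 35/2`, so `R ≥ 6 · (35/33) · m`, i.e.
`11 · R(⟨3,4,m⟩) ≥ 70 · m`. [cite: Nazarov2023FiniteFieldLB, Theorem (K = 2, n = 3, s = 4)] -/
theorem nazarov2023_rank_matMulTensor_34m_gf2 (F : Type) [Field F] [Fintype F] (hF : Fintype.card F = 2)
    (m : ℕ) : 70 * m ≤ 11 * tensorRank (matMulTensor F 3 4 m) := by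
  have h := nazarov2023_rank_matMulTensor_ge_holds F 3 4 m (by norm_num) (by norm_num)
  rw [hF] at h
  have hf : nazarov2023F 2 3 4 = 35 / 2 := by norm_num [nazarov2023F]
  rw [hf] at h
  norm_num at h
  have h2 : (70 : ℚ) * m ≤ 11 * (tensorRank (matMulTensor F 3 4 m) : ℚ) := by linarith
  exact_mod_cast h2

/-- `⟨4,4,m⟩` over a field with `2` elements: `f(2,4,4) = 225/13`, so `R ≥ 7 · (225/212) · m`, i.e.
`212 · R(⟨4,4,m⟩) ≥ 1575 · m`. [cite: Nazarov2023FiniteFieldLB, Theorem (K = 2, s = n = 4)] -/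
theorem nazarov2023_rank_matMulTensor_44m_gf2 (F : Type) [Field F] [Fintype F] (hF : Fintype.card F = 2)
    (m : ℕ) : 1575 * m ≤ 212 * tensorRank (matMulTensor F 4 4 m) := by
  have h := nazarov2023_rank_matMulTensor_ge_holds F 4 4 m (by norm_num) le_rfl
  rw [hF] at h
  have hf : nazarov2023F 2 4 4 = 225 / 13 := by norm_num [nazarov2023F]
  rw [hf] at h
  norm_num at h
  have h2 : (1575 : ℚ) * m ≤ 212 * (tensorRank (matMulTensor F 4 4 m) : ℚ) := by linarith
  exact_mod_cast h2

/-- In particular `R(⟨3,3,8⟩) ≥ 45` over a field with `2` elements (any field: `44`).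
[cite: Nazarov2023FiniteFieldLB, Theorem (K = 2, s = n = 3, m = 8)] -/
theorem nazarov2023_fortyfive_le_tensorRank_matMulTensor_338 (F : Type) [Field F] [Fintype F]
    (hF : Fintype.card F = 2) : 45 ≤ tensorRank (matMulTensor F 3 3 8) := by
  have h := nazarov2023_rank_matMulTensor_33m_gf2 F hF 8
  omega

/-- The bound transported to the rotated formats `⟨s,m,n⟩` and `⟨m,n,s⟩` (rank is invariant under cyclic
rotation of the format — Hopcroft–Musinski duality, in the tree as Bläser 2013 Lemma 5.5), as used in
the source's §4 ("by duality the bound holds for every permutation of `(n, s, m)`").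
[cite: Nazarov2023FiniteFieldLB, §4 (duality remark)] -/
theorem nazarov2023_rank_matMulTensor_ge_rotate (F : Type) [Field F] [Fintype F] (n s m : ℕ)
    (hn : 2 ≤ n) (hns : n ≤ s) :
    ((n + s - 1 : ℕ) : ℚ) * (1 + 1 / (nazarov2023F (Fintype.card F) n s - 1)) * m ≤
        (tensorRank (matMulTensor F s m n) : ℚ) ∧
      ((n + s - 1 : ℕ) : ℚ) * (1 + 1 / (nazarov2023F (Fintype.card F) n s - 1)) * m ≤
        (tensorRank (matMulTensor F m n s) : ℚ) := by
  have h := nazarov2023_rank_matMulTensor_ge_holds F n s m hn hns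
  refine ⟨?_, ?_⟩
  · rw [← tensorRank_matMulTensor_rotate (K := F) n s m]
    exact h
  · rw [tensorRank_matMulTensor_rotate (K := F) m n s]
    exact h

end Literature.Computability.AlgebraicComplexity

end
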